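import Summits.CriticalPhenomena.PercolationContinuityZ3.Theorems.PercGamblersRuinVerticalGamblersRuinDeterministicTime
import Summits.CriticalPhenomena.PercolationContinuityZ3.Theorems.PercGamblersRuinVerticalGamblersRuinStubPathReversal
import Summits.CriticalPhenomena.PercolationContinuityZ3.Theorems.PercGamblersRuinVerticalGamblersRuinDiffusivity

/-!
# Skeleton (lead rev 10 of the BC3 birth line `registered` = `Lines/birth.lean`) for crux
`VerticalGamblersRuin` — stmt-CriticalPhenomena-10642
route `route-CriticalPhenomena-PercGamblersRuin` (sub-problem `PercolationContinuityZ3`), crux #2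
(rank 2, `[difficulty: open-problem]`).  Leads `…-10642-0` (rev 1), `…-c1-0` (rev 2), `…-c2-0` (rev 3–6),
`…-c3-0` (rev 7–9), `…-c4-0` (rev 10, this file), 2026-08-17.

WHAT IS IN THE TREE (leads c2–c3, all `--supports stmt-CriticalPhenomena-10642`, namespace
`…Theorems.VerticalGamblersRuin`): rev 7 `stub_DTC : DT → VerticalGamblersRuin` (p158839); rev 8
`stub_VGRofAC : AC → VerticalGamblersRuin` (p163776); rev 9 `stub_VGRofDiffusivity : DIFF → VerticalGamblersRuin`
(p166748) — the tree certifies DIFF ⇒ AC ⇒ DT ⇒ VerticalGamblersRuin, and rev 9 was closed modulo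
DIFF = positive annealed diffusivity of SRW on the would-be critical infinite cluster.

REV 10 (lead c4).  DIFF is not open but FALSE in the jump world `θ(p_c) > 0`, θ-blindly
(`Cruxes/VerticalGamblersRuin/LeadC4Analysis.md`):
 * (Theorem B) Barsky–Grimmett–Newman (PROVED in the tree: no half-space percolation at `p_c`) makes every
   piece of `C_∞` in an upper half-space finite; summing Kirchhoff's law over such a piece and mass transport
   on the plane lattice show that every stationary integrable flow on `C_∞` has ZERO mean vertical flux;
   by `L²`-duality (orthogonal projection in `⊕_{y∼0} L²(C ∩ {0y open})`) the height cocycle is then an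
   `L²`-limit of coboundaries of bounded functions: `inf_ψ F̃(ψ) = 0`,
   `F̃(ψ) := ∫_{0↔∞} Σ_{y∼0 open} (y₀ + ψ(ω−y) − ψ(ω))² dP`  (stubs `stub_kirchhoffOfWeak`, `stub_zeroMeanFlux`,
   `stub_correctorApprox`);
 * (Theorem A) for every bounded measurable `ψ`, `Λ_T(h²) ≤ 2T·F̃(ψ) + 48‖ψ‖²_∞`, where
   `Λ_T(F) := ∫_{0↔∞} deg·(𝒫^T F)(0) dP` — the elementary half of the Kipnis–Varadhan variational formula:
   for the antisymmetric functional `M_i = Ψ(X_i) − Ψ(X_{i−1})`, `Ψ_ω(x) = x₀ + ψ(ω − x)`, of the reversible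
   environment chain, `E_ann(Σ_{i≤T} M_i)² = T·F̃ − 2P_T` with `P_T = Σ_{r=0}^{T−2}(T−1−r)⟨g, S^r g⟩ ≥ 0`
   (Toeplitz positivity from `λ^{|a−b|} = λ^{a+b} + Σ_{j=1}^{min} λ^{a−j}(1−λ²)λ^{b−j}`, no spectral theorem)
   (stubs `stub_diagonalTerms`, `stub_crossTerms`, `stub_toeplitzPositivity`);
 * (Theorem C, glue) hence `θ(p_c) > 0 ⇒ Λ_T(h²) = o(T)`: SRW on the would-be critical cluster is
   SUBDIFFUSIVE, so `Sig.stub_diffusivity ↔ PercolationContinuityZ3` and `Sig.stub_antiConcentration ↔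
   PercolationContinuityZ3` — the rev 8–9 residues are summit-equivalent.
The composition therefore RETREATS to rev 7: `VerticalGamblersRuin_of (hDT : Sig.stub_DT) := stub_DTC hDT`;
the open stub is DT (deterministic-time displacement of the KILLED walk, `T` unconstrained — not refuted by
subdiffusivity; crux-sized, θ-blind irrefutable).  `sorry` occurs ONLY in the registered stubs of §1b.

History: rev 9 (c3) DIFF; rev 8 (c3) Lyons–Zheng exit bound, AC; rev 7 (c3) DTC; rev 6 (c2)
`stub_coreDelta` ≡ crux (`Lines/birth-dead.md`); rev 1–5 plate decomposition.
-/

noncomputable section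

namespace Summit.CriticalPhenomena.PercolationContinuityZ3.Cruxes.VerticalGamblersRuin.Birth

open MeasureTheory Filter
open Literature.Probability.Percolation Literature.Probability.LatticeModels
open Summit.CriticalPhenomena.PercolationContinuityZ3.Theorems
open Summit.CriticalPhenomena.PercolationContinuityZ3.Theorems.VerticalGamblersRuin
open scoped Classical

/-! ## §1 The stub statements, NAME-KEYED (`Sig.stub_*`)

Vocabulary.  `P := bondPercolation (zdGraph 3) (criticalProbI 3)`; `C := {0 ↔ ∞} = percolatesAt 0`;
`O_y := {ω | s(0,y) ∈ ω}`; `N_ω(x) := ((zdGraph 3).neighborFinset x).filter (fun y => s(x, y) ∈ ω)`;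
`deg_ω(0) := #N_ω(0)`; the configuration SEEN FROM `x` is `ω - x := BondConfig.relabel (sym2Equiv (Site.shift (-x))) ω`
(`s(a,b) ∈ ω - x ↔ s(a+x, b+x) ∈ ω`), entering as a universally quantified `sh` pinned by its formula
(`sh x ω = ω - x`); `𝒫_ω g x := (∑ y ∈ N_ω(x), g y) / #N_ω(x)` the UNKILLED one-step averaging operator
(pinned `Pop`), `(𝒫_ω^T F)(0) = E^ω_0[F(X_T)]`; `E ω T x G = E^ω_x[G [X_0,…,X_T]]` the path functional pinned by
its first-step recursion (`StubPathFunctionalBasics`); height `h x := ((x 0 : ℤ) : ℝ)`; for a bounded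
measurable `ψ : Ω → ℝ` the corrector-shifted height `Ψ_ω(x) := x₀ + ψ(ω - x)`, its Dirichlet energy
`F̃(ψ) := ∫_C Σ_{y ∈ N_ω(0)} (y₀ + ψ(ω - y) - ψ(ω))² dP`, its local drift `g(ω) := (𝒫_ω Ψ_ω)(0) - Ψ_ω(0)` and
`c_r := ∫_C deg·g(ω)·(𝒫_ω^r (x ↦ g(ω - x)))(0) dP = ⟨g, S^r g⟩` (`S` = environment chain). -/

namespace Sig

/-- Name-keyed statement of `stub_DT` (OPEN — the research content of rev 7 and rev 10): **deterministic-time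
displacement of the killed walk.**  If `θ(p_c) > 0` there are `K ≥ 1`, `c > 0`, `N` such that for all
`n ≥ N` some deterministic time `T` has `c ≤ ∫_{0↔∞} (𝒦^T_{ω,(-Kn,Kn)} 1_{n ≤ x₀})(0) dP_{p_c}`
(`𝒦` = SRW operator killed outside the open slab `(-Kn, Kn)`): the killed walk from a typical point of the
would-be critical infinite cluster is displaced by `≥ n` with annealed probability `≥ c`.  This is VERBATIM the
antecedent of the landed `Theorems.VerticalGamblersRuin.stub_DTC` (p158839). -/
def stub_DT : Prop :=
    0 < theta (zdGraph 3) (0 : Site 3) (criticalProbI 3) →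
      ∃ K : ℕ, 0 < K ∧ ∃ c : ℝ, 0 < c ∧ ∃ N : ℕ, ∀ n ≥ N, ∃ T : ℕ,
        ∀ Kop : BondConfig (Site 3) → (Site 3 → ℝ) → Site 3 → ℝ,
          (∀ ω (g : Site 3 → ℝ) (x : Site 3), Kop ω g x =
            if -((K * n : ℕ) : ℤ) < x 0 ∧ x 0 < ((K * n : ℕ) : ℤ) then
              (∑ y ∈ ((zdGraph 3).neighborFinset x).filter (fun y => s(x, y) ∈ ω), g y) /
                ((((zdGraph 3).neighborFinset x).filter (fun y => s(x, y) ∈ ω)).card : ℝ)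
            else 0) →
          c ≤ ∫ ω in percolatesAt (0 : Site 3),
              ((Kop ω)^[T] (fun x => if (n : ℤ) ≤ x 0 then (1 : ℝ) else 0)) 0
              ∂(bondPercolation (zdGraph 3) (criticalProbI 3))

/-- Name-keyed statement of `stub_diagonalTerms` (provable now, Theorem A(i), diagonal): **each
increment of the corrector-shifted height has annealed second moment `F̃(ψ)`** — for the step
`i → i+1` (`i < T`) of the annealed `T`-step walk, `∫_C deg·E^ω_0[(Ψ(X_{i+1}) − Ψ(X_i))²] dP = F̃(ψ)`
(Markov property + `stub_stationarity`). -/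
def stub_diagonalTerms : Prop :=
    ∀ sh : Site 3 → BondConfig (Site 3) → BondConfig (Site 3),
      (∀ (x : Site 3) (ω : BondConfig (Site 3)),
        sh x ω = BondConfig.relabel (sym2Equiv (Site.shift (-x))) ω) →
    ∀ Pop : BondConfig (Site 3) → (Site 3 → ℝ) → Site 3 → ℝ,
      (∀ ω (g : Site 3 → ℝ) (x : Site 3), Pop ω g x =
        (∑ y ∈ ((zdGraph 3).neighborFinset x).filter (fun y => s(x, y) ∈ ω), g y) /
          ((((zdGraph 3).neighborFinset x).filter (fun y => s(x, y) ∈ ω)).card : ℝ)) →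
    ∀ E : BondConfig (Site 3) → ℕ → Site 3 → (List (Site 3) → ℝ) → ℝ,
      (∀ ω (x : Site 3) (G : List (Site 3) → ℝ), E ω 0 x G = G [x]) →
      (∀ ω (T : ℕ) (x : Site 3) (G : List (Site 3) → ℝ), E ω (T + 1) x G =
        (∑ y ∈ ((zdGraph 3).neighborFinset x).filter (fun y => s(x, y) ∈ ω),
            E ω T y (fun l => G (x :: l))) /
          ((((zdGraph 3).neighborFinset x).filter (fun y => s(x, y) ∈ ω)).card : ℝ)) →
    ∀ (ψ : BondConfig (Site 3) → ℝ) (B : ℝ), Measurable ψ → (∀ ω, |ψ ω| ≤ B) →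
    ∀ (T i : ℕ), i < T →
      ∫ ω in percolatesAt (0 : Site 3),
          ((((zdGraph 3).neighborFinset (0 : Site 3)).filter
              (fun y => s((0 : Site 3), y) ∈ ω)).card : ℝ) *
            E ω T 0 (fun l =>
              ((((l.getD (i + 1) 0) 0 : ℤ) : ℝ) + ψ (sh (l.getD (i + 1) 0) ω) -
                ((((l.getD i 0) 0 : ℤ) : ℝ) + ψ (sh (l.getD i 0) ω))) ^ 2)
          ∂(bondPercolation (zdGraph 3) (criticalProbI 3)) =
        ∫ ω in percolatesAt (0 : Site 3),
          ∑ y ∈ ((zdGraph 3).neighborFinset (0 : Site 3)).filter (fun y => s((0 : Site 3), y) ∈ ω),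
            (((y 0 : ℤ) : ℝ) + ψ (sh y ω) - ψ ω) ^ 2
          ∂(bondPercolation (zdGraph 3) (criticalProbI 3))

/-- Name-keyed statement of `stub_crossTerms` (provable now, Theorem A(i), off-diagonal): **the
increments are negatively correlated through the environment chain** — for steps `i < j < T`,
`∫_C deg·E^ω_0[(Ψ(X_{i+1}) − Ψ(X_i))(Ψ(X_{j+1}) − Ψ(X_j))] dP = −c_{j−i−1}`, `c_r = ⟨g, S^r g⟩`
(Markov property, `stub_stationarity`, and the one-step REVERSAL, under which the increment is odd). -/
def stub_crossTerms : Prop :=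
    ∀ sh : Site 3 → BondConfig (Site 3) → BondConfig (Site 3),
      (∀ (x : Site 3) (ω : BondConfig (Site 3)),
        sh x ω = BondConfig.relabel (sym2Equiv (Site.shift (-x))) ω) →
    ∀ Pop : BondConfig (Site 3) → (Site 3 → ℝ) → Site 3 → ℝ,
      (∀ ω (g : Site 3 → ℝ) (x : Site 3), Pop ω g x =
        (∑ y ∈ ((zdGraph 3).neighborFinset x).filter (fun y => s(x, y) ∈ ω), g y) /
          ((((zdGraph 3).neighborFinset x).filter (fun y => s(x, y) ∈ ω)).card : ℝ)) →
    ∀ E : BondConfig (Site 3) → ℕ → Site 3 → (List (Site 3) → ℝ) → ℝ,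
      (∀ ω (x : Site 3) (G : List (Site 3) → ℝ), E ω 0 x G = G [x]) →
      (∀ ω (T : ℕ) (x : Site 3) (G : List (Site 3) → ℝ), E ω (T + 1) x G =
        (∑ y ∈ ((zdGraph 3).neighborFinset x).filter (fun y => s(x, y) ∈ ω),
            E ω T y (fun l => G (x :: l))) /
          ((((zdGraph 3).neighborFinset x).filter (fun y => s(x, y) ∈ ω)).card : ℝ)) →
    ∀ (ψ : BondConfig (Site 3) → ℝ) (B : ℝ), Measurable ψ → (∀ ω, |ψ ω| ≤ B) →
    ∀ g : BondConfig (Site 3) → ℝ,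
      (∀ ω, g ω = Pop ω (fun y => ((y 0 : ℤ) : ℝ) + ψ (sh y ω) - ψ ω) 0) →
    ∀ (T i j : ℕ), i < j → j < T →
      ∫ ω in percolatesAt (0 : Site 3),
          ((((zdGraph 3).neighborFinset (0 : Site 3)).filter
              (fun y => s((0 : Site 3), y) ∈ ω)).card : ℝ) *
            E ω T 0 (fun l =>
              (((((l.getD (i + 1) 0) 0 : ℤ) : ℝ) + ψ (sh (l.getD (i + 1) 0) ω) -
                ((((l.getD i 0) 0 : ℤ) : ℝ) + ψ (sh (l.getD i 0) ω))) *
              (((((l.getD (j + 1) 0) 0 : ℤ) : ℝ) + ψ (sh (l.getD (j + 1) 0) ω) -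
                ((((l.getD j 0) 0 : ℤ) : ℝ) + ψ (sh (l.getD j 0) ω))))))
          ∂(bondPercolation (zdGraph 3) (criticalProbI 3)) =
        -(∫ ω in percolatesAt (0 : Site 3),
            ((((zdGraph 3).neighborFinset (0 : Site 3)).filter
                (fun y => s((0 : Site 3), y) ∈ ω)).card : ℝ) *
              (g ω * ((Pop ω)^[j - i - 1] (fun x => g (sh x ω))) 0)
            ∂(bondPercolation (zdGraph 3) (criticalProbI 3)))

/-- Name-keyed statement of the VARIANCE IDENTITY (Theorem A(i); not a stub — derived below from
`stub_diagonalTerms` + `stub_crossTerms`, `varianceIdentity_of`): `E_ann[(Ψ(X_T) − Ψ(X_0))²] + 2P_T = T·F̃(ψ)`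
with `P_T = Σ_{r=0}^{T−2} (T−1−r)·c_r`. -/
def stub_varianceIdentity : Prop :=
    ∀ sh : Site 3 → BondConfig (Site 3) → BondConfig (Site 3),
      (∀ (x : Site 3) (ω : BondConfig (Site 3)),
        sh x ω = BondConfig.relabel (sym2Equiv (Site.shift (-x))) ω) →
    ∀ Pop : BondConfig (Site 3) → (Site 3 → ℝ) → Site 3 → ℝ,
      (∀ ω (g : Site 3 → ℝ) (x : Site 3), Pop ω g x =
        (∑ y ∈ ((zdGraph 3).neighborFinset x).filter (fun y => s(x, y) ∈ ω), g y) /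
          ((((zdGraph 3).neighborFinset x).filter (fun y => s(x, y) ∈ ω)).card : ℝ)) →
    ∀ E : BondConfig (Site 3) → ℕ → Site 3 → (List (Site 3) → ℝ) → ℝ,
      (∀ ω (x : Site 3) (G : List (Site 3) → ℝ), E ω 0 x G = G [x]) →
      (∀ ω (T : ℕ) (x : Site 3) (G : List (Site 3) → ℝ), E ω (T + 1) x G =
        (∑ y ∈ ((zdGraph 3).neighborFinset x).filter (fun y => s(x, y) ∈ ω),
            E ω T y (fun l => G (x :: l))) /
          ((((zdGraph 3).neighborFinset x).filter (fun y => s(x, y) ∈ ω)).card : ℝ)) →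
    ∀ (ψ : BondConfig (Site 3) → ℝ) (B : ℝ), Measurable ψ → (∀ ω, |ψ ω| ≤ B) →
    ∀ g : BondConfig (Site 3) → ℝ,
      (∀ ω, g ω = Pop ω (fun y => ((y 0 : ℤ) : ℝ) + ψ (sh y ω) - ψ ω) 0) →
    ∀ T : ℕ,
      ∫ ω in percolatesAt (0 : Site 3),
          ((((zdGraph 3).neighborFinset (0 : Site 3)).filter
              (fun y => s((0 : Site 3), y) ∈ ω)).card : ℝ) *
            E ω T 0 (fun l =>
              ((((l.getD T 0) 0 : ℤ) : ℝ) + ψ (sh (l.getD T 0) ω) -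
                ((((l.getD 0 0) 0 : ℤ) : ℝ) + ψ (sh (l.getD 0 0) ω))) ^ 2)
          ∂(bondPercolation (zdGraph 3) (criticalProbI 3)) +
        2 * ∑ r ∈ Finset.range (T - 1), ((T : ℝ) - 1 - r) *
          ∫ ω in percolatesAt (0 : Site 3),
            ((((zdGraph 3).neighborFinset (0 : Site 3)).filter
                (fun y => s((0 : Site 3), y) ∈ ω)).card : ℝ) *
              (g ω * ((Pop ω)^[r] (fun x => g (sh x ω))) 0)
            ∂(bondPercolation (zdGraph 3) (criticalProbI 3)) =
      (T : ℝ) * ∫ ω in percolatesAt (0 : Site 3),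
          ∑ y ∈ ((zdGraph 3).neighborFinset (0 : Site 3)).filter (fun y => s((0 : Site 3), y) ∈ ω),
            (((y 0 : ℤ) : ℝ) + ψ (sh y ω) - ψ ω) ^ 2
          ∂(bondPercolation (zdGraph 3) (criticalProbI 3))

/-- Name-keyed statement of `stub_toeplitzPositivity` (provable now, Theorem A(ii)): **Toeplitz positivity
for the environment chain**, `Σ_{r=0}^{m} (m+1−r)·⟨g, S^r g⟩ ≥ 0` for every bounded measurable `g`. -/
def stub_toeplitzPositivity : Prop :=
    ∀ sh : Site 3 → BondConfig (Site 3) → BondConfig (Site 3),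
      (∀ (x : Site 3) (ω : BondConfig (Site 3)),
        sh x ω = BondConfig.relabel (sym2Equiv (Site.shift (-x))) ω) →
    ∀ Pop : BondConfig (Site 3) → (Site 3 → ℝ) → Site 3 → ℝ,
      (∀ ω (g : Site 3 → ℝ) (x : Site 3), Pop ω g x =
        (∑ y ∈ ((zdGraph 3).neighborFinset x).filter (fun y => s(x, y) ∈ ω), g y) /
          ((((zdGraph 3).neighborFinset x).filter (fun y => s(x, y) ∈ ω)).card : ℝ)) →
    ∀ (g : BondConfig (Site 3) → ℝ) (B : ℝ), Measurable g → (∀ ω, |g ω| ≤ B) →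
    ∀ m : ℕ,
      0 ≤ ∑ r ∈ Finset.range (m + 1), ((m : ℝ) + 1 - r) *
          ∫ ω in percolatesAt (0 : Site 3),
            ((((zdGraph 3).neighborFinset (0 : Site 3)).filter
                (fun y => s((0 : Site 3), y) ∈ ω)).card : ℝ) *
              (g ω * ((Pop ω)^[r] (fun x => g (sh x ω))) 0)
            ∂(bondPercolation (zdGraph 3) (criticalProbI 3))

/-- Name-keyed statement of `stub_kirchhoffOfWeak` (provable now, Theorem B1(a–b)): a family `θ_y` of
integrable edge weights that is WEAKLY Kirchhoff (orthogonal to all coboundaries of bounded functions) has an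
antisymmetrisation `A(ω; x, x+y) := θ_y(ω−x) − θ_{−y}(ω−x−y)` satisfying Kirchhoff's node law at every
vertex of the infinite cluster, almost surely. -/
def stub_kirchhoffOfWeak : Prop :=
    ∀ sh : Site 3 → BondConfig (Site 3) → BondConfig (Site 3),
      (∀ (x : Site 3) (ω : BondConfig (Site 3)),
        sh x ω = BondConfig.relabel (sym2Equiv (Site.shift (-x))) ω) →
    ∀ θ : Site 3 → BondConfig (Site 3) → ℝ, (∀ y, Measurable (θ y)) →
      (∀ y ∈ (zdGraph 3).neighborFinset (0 : Site 3),
        IntegrableOn (θ y) (percolatesAt (0 : Site 3) ∩ {ω | s((0 : Site 3), y) ∈ ω})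
          (bondPercolation (zdGraph 3) (criticalProbI 3))) →
      (∀ (ψ : BondConfig (Site 3) → ℝ) (B : ℝ), Measurable ψ → (∀ ω, |ψ ω| ≤ B) →
        ∑ y ∈ (zdGraph 3).neighborFinset (0 : Site 3),
          ∫ ω in percolatesAt (0 : Site 3) ∩ {ω | s((0 : Site 3), y) ∈ ω},
            θ y ω * (ψ (sh y ω) - ψ ω) ∂(bondPercolation (zdGraph 3) (criticalProbI 3)) = 0) →
      ∀ᵐ ω ∂(bondPercolation (zdGraph 3) (criticalProbI 3)), ∀ x : Site 3,
        sh x ω ∈ percolatesAt (0 : Site 3) →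
          ∑ y ∈ ((zdGraph 3).neighborFinset (0 : Site 3)).filter
              (fun y => s((0 : Site 3), y) ∈ sh x ω),
            (θ y (sh x ω) - θ (-y) (sh y (sh x ω))) = 0

/-- Name-keyed statement of `stub_zeroMeanFlux` (provable now, Theorem B1(c–f)): **no stationary current
through a plane.**  An integrable family `θ_y` whose antisymmetrisation satisfies Kirchhoff's node law at every
cluster vertex a.s. has zero mean vertical flux, `Σ_{y∼0} y₀ ∫_{C ∩ O_y} θ_y dP = 0` — because every piece of
the infinite cluster in the upper half-space is finite (Barsky–Grimmett–Newman, proved in the tree), the flux of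
the antisymmetrised flow out of such a piece through the plane vanishes, and mass transport on the plane lattice
averages this to the mean flux. -/
def stub_zeroMeanFlux : Prop :=
    ∀ sh : Site 3 → BondConfig (Site 3) → BondConfig (Site 3),
      (∀ (x : Site 3) (ω : BondConfig (Site 3)),
        sh x ω = BondConfig.relabel (sym2Equiv (Site.shift (-x))) ω) →
    ∀ θ : Site 3 → BondConfig (Site 3) → ℝ, (∀ y, Measurable (θ y)) →
      (∀ y ∈ (zdGraph 3).neighborFinset (0 : Site 3),
        IntegrableOn (θ y) (percolatesAt (0 : Site 3) ∩ {ω | s((0 : Site 3), y) ∈ ω})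
          (bondPercolation (zdGraph 3) (criticalProbI 3))) →
      (∀ᵐ ω ∂(bondPercolation (zdGraph 3) (criticalProbI 3)), ∀ x : Site 3,
        sh x ω ∈ percolatesAt (0 : Site 3) →
          ∑ y ∈ ((zdGraph 3).neighborFinset (0 : Site 3)).filter
              (fun y => s((0 : Site 3), y) ∈ sh x ω),
            (θ y (sh x ω) - θ (-y) (sh y (sh x ω))) = 0) →
      ∑ y ∈ (zdGraph 3).neighborFinset (0 : Site 3),
        ((y 0 : ℤ) : ℝ) *
          ∫ ω in percolatesAt (0 : Site 3) ∩ {ω | s((0 : Site 3), y) ∈ ω},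
            θ y ω ∂(bondPercolation (zdGraph 3) (criticalProbI 3)) = 0

/-- Name-keyed statement of `stub_correctorApprox` (provable now, Theorem B2): **if every weakly-Kirchhoff
integrable family has zero mean vertical flux, the height cocycle is approximable in Dirichlet energy by
coboundaries of bounded measurable functions**: `∀ ε > 0 ∃ ψ bounded measurable, F̃(ψ) < ε` (orthogonal
projection in the Hilbert space `⊕_{y∼0} L²(C ∩ O_y, P)`). -/
def stub_correctorApprox : Prop :=
    ∀ sh : Site 3 → BondConfig (Site 3) → BondConfig (Site 3),
      (∀ (x : Site 3) (ω : BondConfig (Site 3)),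
        sh x ω = BondConfig.relabel (sym2Equiv (Site.shift (-x))) ω) →
    (∀ θ : Site 3 → BondConfig (Site 3) → ℝ, (∀ y, Measurable (θ y)) →
      (∀ y ∈ (zdGraph 3).neighborFinset (0 : Site 3),
        IntegrableOn (θ y) (percolatesAt (0 : Site 3) ∩ {ω | s((0 : Site 3), y) ∈ ω})
          (bondPercolation (zdGraph 3) (criticalProbI 3))) →
      (∀ (ψ : BondConfig (Site 3) → ℝ) (B : ℝ), Measurable ψ → (∀ ω, |ψ ω| ≤ B) →
        ∑ y ∈ (zdGraph 3).neighborFinset (0 : Site 3),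
          ∫ ω in percolatesAt (0 : Site 3) ∩ {ω | s((0 : Site 3), y) ∈ ω},
            θ y ω * (ψ (sh y ω) - ψ ω) ∂(bondPercolation (zdGraph 3) (criticalProbI 3)) = 0) →
      ∑ y ∈ (zdGraph 3).neighborFinset (0 : Site 3),
        ((y 0 : ℤ) : ℝ) *
          ∫ ω in percolatesAt (0 : Site 3) ∩ {ω | s((0 : Site 3), y) ∈ ω},
            θ y ω ∂(bondPercolation (zdGraph 3) (criticalProbI 3)) = 0) →
    ∀ ε : ℝ, 0 < ε →
      ∃ (ψ : BondConfig (Site 3) → ℝ) (B : ℝ), Measurable ψ ∧ (∀ ω, |ψ ω| ≤ B) ∧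
        ∫ ω in percolatesAt (0 : Site 3),
            ∑ y ∈ ((zdGraph 3).neighborFinset (0 : Site 3)).filter (fun y => s((0 : Site 3), y) ∈ ω),
              (((y 0 : ℤ) : ℝ) + ψ (sh y ω) - ψ ω) ^ 2
            ∂(bondPercolation (zdGraph 3) (criticalProbI 3)) < ε

/-- Name-keyed statement of rev 9's DIFF (no longer a stub: REFUTED in the jump world below,
`stub_diffusivity_iff_continuity`). -/
def stub_diffusivity : Prop :=
    0 < theta (zdGraph 3) (0 : Site 3) (criticalProbI 3) →
    ∃ σ : ℝ, 0 < σ ∧ ∃ T₀ : ℕ, ∀ T ≥ T₀,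
      ∀ Pop : BondConfig (Site 3) → (Site 3 → ℝ) → Site 3 → ℝ,
        (∀ ω (g : Site 3 → ℝ) (x : Site 3), Pop ω g x =
          (∑ y ∈ ((zdGraph 3).neighborFinset x).filter (fun y => s(x, y) ∈ ω), g y) /
            ((((zdGraph 3).neighborFinset x).filter (fun y => s(x, y) ∈ ω)).card : ℝ)) →
        σ * (T : ℝ) ≤ ∫ ω in percolatesAt (0 : Site 3),
            ((((zdGraph 3).neighborFinset (0 : Site 3)).filter
                (fun y => s((0 : Site 3), y) ∈ ω)).card : ℝ) *
              ((Pop ω)^[T] (fun x => ((x 0 : ℤ) : ℝ) ^ 2)) 0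
            ∂(bondPercolation (zdGraph 3) (criticalProbI 3))

/-- Name-keyed statement of rev 8's AC (no longer a stub: REFUTED in the jump world below,
`stub_antiConcentration_iff_continuity`). -/
def stub_antiConcentration : Prop :=
    0 < theta (zdGraph 3) (0 : Site 3) (criticalProbI 3) →
    ∃ c : ℝ, 0 < c ∧ ∀ C₀ : ℝ, 0 < C₀ → ∃ K : ℕ, 0 < K ∧ ∃ N : ℕ, ∀ n ≥ N, ∃ T : ℕ,
      C₀ * (T : ℝ) ≤ c * (((K * n : ℕ) : ℝ) ^ 2) ∧
      ∀ Pop : BondConfig (Site 3) → (Site 3 → ℝ) → Site 3 → ℝ,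
        (∀ ω (g : Site 3 → ℝ) (x : Site 3), Pop ω g x =
          (∑ y ∈ ((zdGraph 3).neighborFinset x).filter (fun y => s(x, y) ∈ ω), g y) /
            ((((zdGraph 3).neighborFinset x).filter (fun y => s(x, y) ∈ ω)).card : ℝ)) →
        2 * c ≤ ∫ ω in percolatesAt (0 : Site 3),
            ((Pop ω)^[T] (fun x => if (n : ℤ) ≤ x 0 then (1 : ℝ) else 0)) 0
            ∂(bondPercolation (zdGraph 3) (criticalProbI 3))

end Sig

/-! ## §1b Registered stubs (`sorry` occurs ONLY here) -/

/-- **stub `stub_DT` (OPEN — the research content): deterministic-time displacement of the killed walk.**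
See `Sig.stub_DT`.  Why it might fail: in the jump world the walk on `C_∞` is subdiffusive (Theorem C of this
file) with no known two-sided control; DT asks that at SOME deterministic time the killed walk be displaced by
`n` while its running maximum stayed `< Kn` with annealed probability `≥ c` — true for every walk with
sub-Gaussian-type two-sided bounds, false for "homebodies" (LeadC3Analysis §2); no θ-blind handle is known. -/
theorem stub_DT :
    0 < theta (zdGraph 3) (0 : Site 3) (criticalProbI 3) →
      ∃ K : ℕ, 0 < K ∧ ∃ c : ℝ, 0 < c ∧ ∃ N : ℕ, ∀ n ≥ N, ∃ T : ℕ,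
        ∀ Kop : BondConfig (Site 3) → (Site 3 → ℝ) → Site 3 → ℝ,
          (∀ ω (g : Site 3 → ℝ) (x : Site 3), Kop ω g x =
            if -((K * n : ℕ) : ℤ) < x 0 ∧ x 0 < ((K * n : ℕ) : ℤ) then
              (∑ y ∈ ((zdGraph 3).neighborFinset x).filter (fun y => s(x, y) ∈ ω), g y) /
                ((((zdGraph 3).neighborFinset x).filter (fun y => s(x, y) ∈ ω)).card : ℝ)
            else 0) →
          c ≤ ∫ ω in percolatesAt (0 : Site 3),
              ((Kop ω)^[T] (fun x => if (n : ℤ) ≤ x 0 then (1 : ℝ) else 0)) 0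
              ∂(bondPercolation (zdGraph 3) (criticalProbI 3)) := by
  sorry

/-- **stub `stub_diagonalTerms` (provable now, size M–L): Theorem A(i), diagonal terms.**
`∫_C deg·E^ω_0[(Ψ(X_{i+1}) − Ψ(X_i))²] dP = F̃(ψ)` for `i < T`, `Ψ_ω(x) = x₀ + ψ(ω − x)`.  Proof plan
(LeadC4Analysis §1): (1) PREFIX: the functional depends only on `X_0..X_{i+1}`, so `E ω T 0 (…) =
E ω (i+1) 0 (…)` (last-step recursion `StubPathReversal.succ_eq_last` + mass one at every vertex reached
through an open edge, `StubForwardKolmogorov.mass_one`; at time `0` the factor `deg_ω(0)` kills the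
degenerate case); (2) LAST STEP at time `i+1` (`succ_eq_last`): the functional becomes
`l ↦ g₂(ω − l_i)` with `g₂(ω') := Σ_{y∈N_{ω'}(0)} (y₀ + ψ(ω'−y) − ψ(ω'))² / deg_{ω'}(0)`, by the SHIFT
COVARIANCE of the increments `Ψ_ω(z+y) − Ψ_ω(z) = y₀ + ψ((ω−z)−y) − ψ(ω−z)` (`(ω−z)−y = ω−(y+z)`,
`StubStationarity.relabel_shift_neg_relabel_shift_neg`; neighbours `mem_filter_relabel_shift_neg_iff`);
(3) LINK `E ω i 0 (l ↦ f(l_i)) = (𝒫^i f)(0)` (`stub_pathFunctionalBasics`, conjunct 7) and STATIONARITY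
`∫_C deg·(𝒫^i (x ↦ g₂(ω−x)))(0) = ∫_C deg·g₂` (`stub_stationarity`, after rescaling `g₂ ∈ [0,(1+2B)²]` to
`[0,1]`, `Diffusivity.full_iterate_smul`; measurability as in `StubStationarity.measurable_pop_zero`);
(4) `deg·g₂ = Σ_{y∈N(0)} (…)²` (and both vanish when `deg = 0`). -/
theorem stub_diagonalTerms :
    ∀ sh : Site 3 → BondConfig (Site 3) → BondConfig (Site 3),
      (∀ (x : Site 3) (ω : BondConfig (Site 3)),
        sh x ω = BondConfig.relabel (sym2Equiv (Site.shift (-x))) ω) →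
    ∀ Pop : BondConfig (Site 3) → (Site 3 → ℝ) → Site 3 → ℝ,
      (∀ ω (g : Site 3 → ℝ) (x : Site 3), Pop ω g x =
        (∑ y ∈ ((zdGraph 3).neighborFinset x).filter (fun y => s(x, y) ∈ ω), g y) /
          ((((zdGraph 3).neighborFinset x).filter (fun y => s(x, y) ∈ ω)).card : ℝ)) →
    ∀ E : BondConfig (Site 3) → ℕ → Site 3 → (List (Site 3) → ℝ) → ℝ,
      (∀ ω (x : Site 3) (G : List (Site 3) → ℝ), E ω 0 x G = G [x]) →
      (∀ ω (T : ℕ) (x : Site 3) (G : List (Site 3) → ℝ), E ω (T + 1) x G =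
        (∑ y ∈ ((zdGraph 3).neighborFinset x).filter (fun y => s(x, y) ∈ ω),
            E ω T y (fun l => G (x :: l))) /
          ((((zdGraph 3).neighborFinset x).filter (fun y => s(x, y) ∈ ω)).card : ℝ)) →
    ∀ (ψ : BondConfig (Site 3) → ℝ) (B : ℝ), Measurable ψ → (∀ ω, |ψ ω| ≤ B) →
    ∀ (T i : ℕ), i < T →
      ∫ ω in percolatesAt (0 : Site 3),
          ((((zdGraph 3).neighborFinset (0 : Site 3)).filter
              (fun y => s((0 : Site 3), y) ∈ ω)).card : ℝ) *
            E ω T 0 (fun l =>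
              ((((l.getD (i + 1) 0) 0 : ℤ) : ℝ) + ψ (sh (l.getD (i + 1) 0) ω) -
                ((((l.getD i 0) 0 : ℤ) : ℝ) + ψ (sh (l.getD i 0) ω))) ^ 2)
          ∂(bondPercolation (zdGraph 3) (criticalProbI 3)) =
        ∫ ω in percolatesAt (0 : Site 3),
          ∑ y ∈ ((zdGraph 3).neighborFinset (0 : Site 3)).filter (fun y => s((0 : Site 3), y) ∈ ω),
            (((y 0 : ℤ) : ℝ) + ψ (sh y ω) - ψ ω) ^ 2
          ∂(bondPercolation (zdGraph 3) (criticalProbI 3))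
    := by
  sorry

/-- **stub `stub_crossTerms` (provable now, size L): Theorem A(i), cross terms.**  For `i < j < T`:
`∫_C deg·E^ω_0[(Ψ(X_{i+1})−Ψ(X_i))·(Ψ(X_{j+1})−Ψ(X_j))] dP = −c_{j−i−1}`,
`c_r = ∫_C deg·g·(𝒫^r (x ↦ g(ω−x)))(0) dP`, `g = 𝒫Ψ − Ψ` at `0` (pinned by `hg`).  Proof plan (LeadC4Analysis
§1): (1) PREFIX to time `j+1`, LAST STEP at `j+1`: the second factor averages to the drift
`g(ω − l_j)` (shift covariance as in `stub_diagonalTerms`); (2) MARKOV at time `i+1`: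
`E ω j 0 (l ↦ H(l_0..l_{i+1})·G(l_j)) = E ω (i+1) 0 (l ↦ H(l)·(𝒫^{j−i−1} G)(l_{i+1}))` with `G(x) = g(ω−x)`
(induction via `succ_eq_last`; the case `H = 1` is the prefix property); (3) LAST STEP at `i+1` and the
ITERATE COVARIANCE `(𝒫^r_ω G_ω)(z+y) = (𝒫^r_{ω−z} G_{ω−z})(y)` (`StubStationarity.pop_seen_from`, iterated)
give the functional `l ↦ k(ω − l_i)`, `k(ω') := Σ_{y∈N_{ω'}(0)} (y₀ + ψ(ω'−y) − ψ(ω'))·(𝒫^r_{ω'}G_{ω'})(y)/deg`;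
(4) LINK + STATIONARITY (signed bounded `k`: rescale affinely to `[0,1]`, use `stub_stationarity` for it
and for the constant `1`, linearity `Diffusivity.full_iterate_add/smul`): `= ∫_C deg·k = ∫_C Σ_{y∈N(0)}
(y₀+ψ(ω−y)−ψ(ω))·(𝒫^r_ω G_ω)(y)`; (5) ONE-STEP REVERSAL `∫_C Σ_{z∈N(0)} F(ω−z, z) = ∫_C Σ_{y∈N(0)} F(ω,−y)`
(`StubPathReversal.setIntegral_sum_relabel`, after affine rescaling to `[0,1]`) with
`F(ω', z) := (z₀ + ψ(ω') − ψ(ω' − (−z)))·(𝒫^r_{ω'} G_{ω'})(0)` — note `(𝒫^r_ω G_ω)(z) = (𝒫^r_{ω−z}G_{ω−z})(0)`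
and `ψ(ω) = ψ((ω−z)−(−z))` (`relabel_shift_neg_relabel_shift_neg`, `relabel_shift_neg_zero`) — turns the
integrand into `Σ_y (−y₀ + ψ(ω) − ψ(ω−y))·(𝒫^r G)(0) = −deg·g·(𝒫^r G)(0)`. -/
theorem stub_crossTerms :
    ∀ sh : Site 3 → BondConfig (Site 3) → BondConfig (Site 3),
      (∀ (x : Site 3) (ω : BondConfig (Site 3)),
        sh x ω = BondConfig.relabel (sym2Equiv (Site.shift (-x))) ω) →
    ∀ Pop : BondConfig (Site 3) → (Site 3 → ℝ) → Site 3 → ℝ,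
      (∀ ω (g : Site 3 → ℝ) (x : Site 3), Pop ω g x =
        (∑ y ∈ ((zdGraph 3).neighborFinset x).filter (fun y => s(x, y) ∈ ω), g y) /
          ((((zdGraph 3).neighborFinset x).filter (fun y => s(x, y) ∈ ω)).card : ℝ)) →
    ∀ E : BondConfig (Site 3) → ℕ → Site 3 → (List (Site 3) → ℝ) → ℝ,
      (∀ ω (x : Site 3) (G : List (Site 3) → ℝ), E ω 0 x G = G [x]) →
      (∀ ω (T : ℕ) (x : Site 3) (G : List (Site 3) → ℝ), E ω (T + 1) x G =
        (∑ y ∈ ((zdGraph 3).neighborFinset x).filter (fun y => s(x, y) ∈ ω),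
            E ω T y (fun l => G (x :: l))) /
          ((((zdGraph 3).neighborFinset x).filter (fun y => s(x, y) ∈ ω)).card : ℝ)) →
    ∀ (ψ : BondConfig (Site 3) → ℝ) (B : ℝ), Measurable ψ → (∀ ω, |ψ ω| ≤ B) →
    ∀ g : BondConfig (Site 3) → ℝ,
      (∀ ω, g ω = Pop ω (fun y => ((y 0 : ℤ) : ℝ) + ψ (sh y ω) - ψ ω) 0) →
    ∀ (T i j : ℕ), i < j → j < T →
      ∫ ω in percolatesAt (0 : Site 3),
          ((((zdGraph 3).neighborFinset (0 : Site 3)).filter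
              (fun y => s((0 : Site 3), y) ∈ ω)).card : ℝ) *
            E ω T 0 (fun l =>
              (((((l.getD (i + 1) 0) 0 : ℤ) : ℝ) + ψ (sh (l.getD (i + 1) 0) ω) -
                ((((l.getD i 0) 0 : ℤ) : ℝ) + ψ (sh (l.getD i 0) ω))) *
              (((((l.getD (j + 1) 0) 0 : ℤ) : ℝ) + ψ (sh (l.getD (j + 1) 0) ω) -
                ((((l.getD j 0) 0 : ℤ) : ℝ) + ψ (sh (l.getD j 0) ω))))))
          ∂(bondPercolation (zdGraph 3) (criticalProbI 3)) =
        -(∫ ω in percolatesAt (0 : Site 3),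
            ((((zdGraph 3).neighborFinset (0 : Site 3)).filter
                (fun y => s((0 : Site 3), y) ∈ ω)).card : ℝ) *
              (g ω * ((Pop ω)^[j - i - 1] (fun x => g (sh x ω))) 0)
            ∂(bondPercolation (zdGraph 3) (criticalProbI 3)))
    := by
  sorry

/-- **stub `stub_toeplitzPositivity` (provable now, size M–L): Theorem A(ii).**  For bounded measurable `g`,
with `c_r := ∫_C deg·g·(𝒫^r (x ↦ g(ω−x)))(0) dP = ⟨g, S^r g⟩`: `Σ_{r=0}^{m} (m+1−r) c_r ≥ 0`.
Proof plan (LeadC4Analysis §1(ii)): `2·Σ_{r=0}^m (m+1−r)c_r = (m+1)c_0 + Σ_{a,b=0}^{m} c_{|a−b|}`, `c_0 = ⟨g,g⟩ ≥ 0`,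
and `Σ_{a,b=0}^m c_{|a−b|} = ‖Σ_{a=0}^m S^a g‖² + Σ_{j=1}^m (‖u_j‖² − ‖S u_j‖²)`, `u_j = Σ_{i=0}^{m−j} S^i g`
(sum over `a, b` of the polynomial identity `λ^{|a−b|} = λ^{a+b} + Σ_{j=1}^{min(a,b)} λ^{a−j}(1−λ²)λ^{b−j}`), using
only `⟨S^a g, S^b g⟩ = c_{a+b}` — SELF-ADJOINTNESS `⟨f, S k⟩ = ⟨S f, k⟩` (one-step reversal
`StubPathReversal.setIntegral_sum_relabel` / `StubStationarity.setIntegral_ite_relabel`) and the SEMIGROUP law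
`S^a S^b = S^{a+b}` (shift covariance `StubStationarity.pop_seen_from`, iterated) — and the CONTRACTION
`‖S u‖² ≤ ‖u‖²` (Jensen `(𝒫 U)(0)² ≤ 𝒫(U²)(0)` + `stub_stationarity`).  Here `⟨f,k⟩ = ∫_C deg·f·k dP`,
`(S k)(ω) = (𝒫_ω (x ↦ k(ω−x)))(0)`; bounded measurable functions are closed under `S`
(`StubStationarity.measurable_pop_zero`, `pop_zero_mem_Icc`). -/
theorem stub_toeplitzPositivity :
    ∀ sh : Site 3 → BondConfig (Site 3) → BondConfig (Site 3),
      (∀ (x : Site 3) (ω : BondConfig (Site 3)),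
        sh x ω = BondConfig.relabel (sym2Equiv (Site.shift (-x))) ω) →
    ∀ Pop : BondConfig (Site 3) → (Site 3 → ℝ) → Site 3 → ℝ,
      (∀ ω (g : Site 3 → ℝ) (x : Site 3), Pop ω g x =
        (∑ y ∈ ((zdGraph 3).neighborFinset x).filter (fun y => s(x, y) ∈ ω), g y) /
          ((((zdGraph 3).neighborFinset x).filter (fun y => s(x, y) ∈ ω)).card : ℝ)) →
    ∀ (g : BondConfig (Site 3) → ℝ) (B : ℝ), Measurable g → (∀ ω, |g ω| ≤ B) →
    ∀ m : ℕ,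
      0 ≤ ∑ r ∈ Finset.range (m + 1), ((m : ℝ) + 1 - r) *
          ∫ ω in percolatesAt (0 : Site 3),
            ((((zdGraph 3).neighborFinset (0 : Site 3)).filter
                (fun y => s((0 : Site 3), y) ∈ ω)).card : ℝ) *
              (g ω * ((Pop ω)^[r] (fun x => g (sh x ω))) 0)
            ∂(bondPercolation (zdGraph 3) (criticalProbI 3)) := by
  sorry

/-- **stub `stub_kirchhoffOfWeak` (provable now, size M): Theorem B1(a–b).**  Proof plan (LeadC4Analysis
§2): the substitution `ω' = ω − y` (translation invariance `bondPercolation_map_shift`; it maps `C ∩ O_y` onto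
`C ∩ O_{−y}`: `relabel_mem_percolatesAt_iff` + "an open edge joins the clusters of its endpoints",
`StubClusterComparison.mem_percolatesAt_iff_of_mem_filter`; cf. `StubStationarity.setIntegral_ite_relabel`)
turns weak Kirchhoff into `∫_C ψ·Φ dP = 0` for all bounded measurable `ψ`, where
`Φ(ω) = Σ_{y∈N_ω(0)} (θ_{−y}(ω−y) − θ_y(ω))`; taking `ψ = clamp(Φ)·1_C` gives `Φ = 0` a.e. on `C`, i.e. the
claim at `x = 0` (`ω − 0 = ω`, `StubStationarity.relabel_shift_neg_zero`); the claim at a general `x` is the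
same null set transported by the measure-preserving shift `ω ↦ ω − x` (countable union over `x`;
`(ω − x) − y = ω − (y + x)`, `StubStationarity.relabel_shift_neg_relabel_shift_neg`). -/
theorem stub_kirchhoffOfWeak :
    ∀ sh : Site 3 → BondConfig (Site 3) → BondConfig (Site 3),
      (∀ (x : Site 3) (ω : BondConfig (Site 3)),
        sh x ω = BondConfig.relabel (sym2Equiv (Site.shift (-x))) ω) →
    ∀ θ : Site 3 → BondConfig (Site 3) → ℝ, (∀ y, Measurable (θ y)) →
      (∀ y ∈ (zdGraph 3).neighborFinset (0 : Site 3),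
        IntegrableOn (θ y) (percolatesAt (0 : Site 3) ∩ {ω | s((0 : Site 3), y) ∈ ω})
          (bondPercolation (zdGraph 3) (criticalProbI 3))) →
      (∀ (ψ : BondConfig (Site 3) → ℝ) (B : ℝ), Measurable ψ → (∀ ω, |ψ ω| ≤ B) →
        ∑ y ∈ (zdGraph 3).neighborFinset (0 : Site 3),
          ∫ ω in percolatesAt (0 : Site 3) ∩ {ω | s((0 : Site 3), y) ∈ ω},
            θ y ω * (ψ (sh y ω) - ψ ω) ∂(bondPercolation (zdGraph 3) (criticalProbI 3)) = 0) →
      ∀ᵐ ω ∂(bondPercolation (zdGraph 3) (criticalProbI 3)), ∀ x : Site 3,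
        sh x ω ∈ percolatesAt (0 : Site 3) →
          ∑ y ∈ ((zdGraph 3).neighborFinset (0 : Site 3)).filter
              (fun y => s((0 : Site 3), y) ∈ sh x ω),
            (θ y (sh x ω) - θ (-y) (sh y (sh x ω))) = 0 := by
  sorry

/-- **stub `stub_zeroMeanFlux` (provable now, size L): Theorem B1(c–f) — no stationary current through a
plane.**  Proof plan (LeadC4Analysis §2): put `A(ω; x, x+y) := θ_y(ω−x) − θ_{−y}(ω−(x+y))` (exactly
antisymmetric; Kirchhoff at every `x ∈ C_∞(ω)` a.s. is the hypothesis, since `ω − x ∈ C ↔ x ∈ C_∞(ω)`).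
(c) FINITE UP-PIECES: a.s. for every `x` with `x₀ ≥ 1` the open cluster `U(x)` of `x` inside the half-space
`{z₀ ≥ 1}` is finite (`FreeBoxSparse.StubCeiling.real_percolatesVia_halfSpace_depth 1 x`, module
`…Theorems.PercNonProliferationFreeBoxSparseStubCeilingPath`, countable union).  (d) PIECE SUM: for `x ∈ C_∞`,
`0 = Σ_{z∈U(x)} Σ_{y: s(z,z+y)∈ω} A(z, z+y)`; edges inside `U(x)` cancel in pairs (antisymmetry, `Finset.sum_comm`
/ involution), and an open edge leaving `U(x)` goes from height `1` straight down (maximality of the piece), so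
`Σ_{z ∈ U(x), z₀ = 1, s(z, z−e₀)∈ω} A(z, z−e₀) = 0`.  (e) MASS TRANSPORT on the plane lattice `V = {z₀ = 1}`: with
`f(z) := 1_{z∈C_∞, s(z,z−e₀)∈ω} A(z, z−e₀)` and `α(z) :=` the lexicographically least vertex of `U(z) ∩ V`
(`α(z) := z` if `U(z)` is infinite), `F(z, w) := f(z)·1_{α(z)=w}` is invariant under simultaneous horizontal shifts
of `(z, w, ω)` and `Σ_w E|F(e₀, w)| = E|f(e₀)| < ∞`, so `E f(e₀) = E Σ_w F(e₀, w) = E Σ_z F(z, e₀) = 0` by (d)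
(`{z : α(z) = e₀} = U(e₀) ∩ V` or `∅`; Fubini–Tonelli over `ℤ²` + `bondPercolation_map_shift`).  (f) Unfolding,
`E f(e₀) = ∫_{C∩O_{−e₀}} θ_{−e₀} − ∫_{C∩O_{e₀}} θ_{e₀}` (shift the first term to the origin as in
`stub_kirchhoffOfWeak`); the four horizontal neighbours have `y₀ = 0` and `(±e₀)₀ = ±1`
(`zdGraph_neighborFinset_zero` enumeration, cf. `StubHeightSymmetry`). -/
theorem stub_zeroMeanFlux :
    ∀ sh : Site 3 → BondConfig (Site 3) → BondConfig (Site 3),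
      (∀ (x : Site 3) (ω : BondConfig (Site 3)),
        sh x ω = BondConfig.relabel (sym2Equiv (Site.shift (-x))) ω) →
    ∀ θ : Site 3 → BondConfig (Site 3) → ℝ, (∀ y, Measurable (θ y)) →
      (∀ y ∈ (zdGraph 3).neighborFinset (0 : Site 3),
        IntegrableOn (θ y) (percolatesAt (0 : Site 3) ∩ {ω | s((0 : Site 3), y) ∈ ω})
          (bondPercolation (zdGraph 3) (criticalProbI 3))) →
      (∀ᵐ ω ∂(bondPercolation (zdGraph 3) (criticalProbI 3)), ∀ x : Site 3,
        sh x ω ∈ percolatesAt (0 : Site 3) →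
          ∑ y ∈ ((zdGraph 3).neighborFinset (0 : Site 3)).filter
              (fun y => s((0 : Site 3), y) ∈ sh x ω),
            (θ y (sh x ω) - θ (-y) (sh y (sh x ω))) = 0) →
      ∑ y ∈ (zdGraph 3).neighborFinset (0 : Site 3),
        ((y 0 : ℤ) : ℝ) *
          ∫ ω in percolatesAt (0 : Site 3) ∩ {ω | s((0 : Site 3), y) ∈ ω},
            θ y ω ∂(bondPercolation (zdGraph 3) (criticalProbI 3)) = 0 := by
  sorry

/-- **stub `stub_correctorApprox` (provable now, size M–L): Theorem B2 — Hilbert-space duality.**  Proof plan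
(LeadC4Analysis §2): index the six neighbours by the Fintype `↥((zdGraph 3).neighborFinset 0)`; put
`μ_y := P.restrict (C ∩ O_y)`, `H := PiLp 2 (fun y => Lp ℝ 2 μ_y)` (real inner product space, complete),
`b := (MemLp.toLp (fun _ => (y 0 : ℝ)) _)_y ∈ H`, and for bounded measurable `ψ`
`grad ψ := (MemLp.toLp (fun ω => ψ (sh y ω) - ψ ω) _)_y` (bounded measurable ⇒ `MemLp _ 2` on a finite measure);
`K := (Submodule.span ℝ {v | ∃ ψ B, Measurable ψ ∧ (∀ ω, |ψ ω| ≤ B) ∧ v = grad ψ}).topologicalClosure` (the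
generating set is already a subspace, `grad` being linear).  `θ := b − K.starProjection b` satisfies
`⟪θ, grad ψ⟫ = 0` (`Submodule.starProjection_inner_eq_zero`, `subset_span`, `le_topologicalClosure`); unfolding
`PiLp.inner_apply` + `MeasureTheory.L2.inner_def` + `integral` of `toLp` representatives (`MemLp.coeFn_toLp`,
`integral_congr_ae`) this is weak Kirchhoff for measurable representatives `θ_y` of the components
(`(Lp.aestronglyMeasurable _).measurable_mk`-type modification, integrable as `L² ⊂ L¹` on a finite measure,
`Lp.memLp`, `MemLp.integrable one_le_two`); the hypothesis gives `Σ_y y₀ ∫ θ_y dμ_y = 0`, which is `⟪b, θ⟫ = 0`;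
but `⟪b, θ⟫ = ⟪θ + K.starProjection b, θ⟫ = ‖θ‖²` (`starProjection_apply_mem` ⊥ θ), so `θ = 0`, `b ∈ K`, and
`Metric.mem_closure_iff` yields `grad ψ` with `‖b − grad ψ‖² < ε`; finally
`‖b − grad ψ‖² = Σ_y ∫_{C∩O_y} (y₀ − (ψ(ω−y) − ψ ω))² dP` (`PiLp.norm_sq_eq_of_L2`, `L2.norm_sq_eq_inner'` /
`Lp.norm_def`) `= ∫_C Σ_{y∈N_ω(0)} (…)² dP` (indicator of `O_y`, `Finset.sum_filter`, `integral_finset_sum`), and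
`ψ ↦ −ψ` puts it in the stated form. -/
theorem stub_correctorApprox :
    ∀ sh : Site 3 → BondConfig (Site 3) → BondConfig (Site 3),
      (∀ (x : Site 3) (ω : BondConfig (Site 3)),
        sh x ω = BondConfig.relabel (sym2Equiv (Site.shift (-x))) ω) →
    (∀ θ : Site 3 → BondConfig (Site 3) → ℝ, (∀ y, Measurable (θ y)) →
      (∀ y ∈ (zdGraph 3).neighborFinset (0 : Site 3),
        IntegrableOn (θ y) (percolatesAt (0 : Site 3) ∩ {ω | s((0 : Site 3), y) ∈ ω})
          (bondPercolation (zdGraph 3) (criticalProbI 3))) →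
      (∀ (ψ : BondConfig (Site 3) → ℝ) (B : ℝ), Measurable ψ → (∀ ω, |ψ ω| ≤ B) →
        ∑ y ∈ (zdGraph 3).neighborFinset (0 : Site 3),
          ∫ ω in percolatesAt (0 : Site 3) ∩ {ω | s((0 : Site 3), y) ∈ ω},
            θ y ω * (ψ (sh y ω) - ψ ω) ∂(bondPercolation (zdGraph 3) (criticalProbI 3)) = 0) →
      ∑ y ∈ (zdGraph 3).neighborFinset (0 : Site 3),
        ((y 0 : ℤ) : ℝ) *
          ∫ ω in percolatesAt (0 : Site 3) ∩ {ω | s((0 : Site 3), y) ∈ ω},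
            θ y ω ∂(bondPercolation (zdGraph 3) (criticalProbI 3)) = 0) →
    ∀ ε : ℝ, 0 < ε →
      ∃ (ψ : BondConfig (Site 3) → ℝ) (B : ℝ), Measurable ψ ∧ (∀ ω, |ψ ω| ≤ B) ∧
        ∫ ω in percolatesAt (0 : Site 3),
            ∑ y ∈ ((zdGraph 3).neighborFinset (0 : Site 3)).filter (fun y => s((0 : Site 3), y) ∈ ω),
              (((y 0 : ℤ) : ℝ) + ψ (sh y ω) - ψ ω) ^ 2
            ∂(bondPercolation (zdGraph 3) (criticalProbI 3)) < ε := by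
  sorry

/-! ### Consistency: each name-keyed statement IS its stub (definitionally) -/

theorem stub_DT_registered : Sig.stub_DT := stub_DT
theorem stub_diagonalTerms_registered : Sig.stub_diagonalTerms := stub_diagonalTerms
theorem stub_crossTerms_registered : Sig.stub_crossTerms := stub_crossTerms
theorem stub_toeplitzPositivity_registered : Sig.stub_toeplitzPositivity := stub_toeplitzPositivity
theorem stub_kirchhoffOfWeak_registered : Sig.stub_kirchhoffOfWeak := stub_kirchhoffOfWeak
theorem stub_zeroMeanFlux_registered : Sig.stub_zeroMeanFlux := stub_zeroMeanFlux
theorem stub_correctorApprox_registered : Sig.stub_correctorApprox := stub_correctorApprox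

/-! ## §3 Assembly (sorry-free): the crux BY NAME from DT -/

/-- **`VerticalGamblersRuin_of`** — the composition, kernel-checked without `sorry`; its conclusion is
LITERALLY the route decl `…Theses.PercGamblersRuin.VerticalGamblersRuin`, via the LANDED deterministic-time
criterion `Theorems.VerticalGamblersRuin.stub_DTC : DT → VerticalGamblersRuin` (p158839). -/
theorem VerticalGamblersRuin_of (hDT : Sig.stub_DT) :
    Summit.CriticalPhenomena.PercolationContinuityZ3.Theses.PercGamblersRuin.VerticalGamblersRuin :=
  Summit.CriticalPhenomena.PercolationContinuityZ3.Theorems.VerticalGamblersRuin.stub_DTC hDT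

/-- Wiring check: the registered stub, as stated, feeds `VerticalGamblersRuin_of`. -/
example : Summit.CriticalPhenomena.PercolationContinuityZ3.Theses.PercGamblersRuin.VerticalGamblersRuin :=
  VerticalGamblersRuin_of stub_DT

/-! ## §4 Glue (sorry-free): Theorem A(iii), Theorem C, and the summit-equivalence of DIFF and AC -/

section Glue

/-- The drift of the corrector-shifted height is bounded: `|g| ≤ 1 + 2B`. [folklore] -/
theorem abs_avg_le {ι : Type*} (s : Finset ι) (f : ι → ℝ) {M : ℝ} (hM : 0 ≤ M)
    (hf : ∀ i ∈ s, |f i| ≤ M) : |(∑ i ∈ s, f i) / (s.card : ℝ)| ≤ M := by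
  rcases s.eq_empty_or_nonempty with hs | hs
  · simp [hs, hM]
  · have hpos : (0 : ℝ) < s.card := by exact_mod_cast hs.card_pos
    rw [abs_div, abs_of_pos hpos, div_le_iff₀ hpos]
    calc |∑ i ∈ s, f i| ≤ ∑ i ∈ s, |f i| := Finset.abs_sum_le_sum_abs _ _
      _ ≤ ∑ i ∈ s, M := Finset.sum_le_sum hf
      _ = M * s.card := by rw [Finset.sum_const, nsmul_eq_mul, mul_comm]

/-- Lattice neighbours of the origin have height in `{-1, 0, 1}`. [folklore] -/
theorem abs_height_le_one_of_mem {y : Site 3} (hy : y ∈ (zdGraph 3).neighborFinset (0 : Site 3)) :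
    |((y 0 : ℤ) : ℝ)| ≤ 1 := by
  rw [SimpleGraph.mem_neighborFinset] at hy
  have h1 : y 0 ≤ (0 : Site 3) 0 + 1 := SlabVoltage.apply_zero_le_of_adj hy
  have h2 : (0 : Site 3) 0 ≤ y 0 + 1 := SlabVoltage.apply_zero_le_of_adj hy.symm
  simp only [Pi.zero_apply] at h1 h2
  rw [abs_le]
  constructor
  · exact_mod_cast (by omega : (-1 : ℤ) ≤ y 0)
  · exact_mod_cast (by omega : y 0 ≤ 1)

/-- Square of a finite sum: diagonal plus twice the ordered off-diagonal part. [folklore] -/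
theorem sq_sum_range (f : ℕ → ℝ) (n : ℕ) :
    (∑ i ∈ Finset.range n, f i) ^ 2 =
      ∑ i ∈ Finset.range n, f i ^ 2 + 2 * ∑ j ∈ Finset.range n, ∑ i ∈ Finset.range j, f i * f j := by
  induction n with
  | zero => simp
  | succ n ih =>
    rw [Finset.sum_range_succ, add_sq, ih, Finset.sum_range_succ (fun i => f i ^ 2),
      Finset.sum_range_succ (fun j => ∑ i ∈ Finset.range j, f i * f j), ← Finset.sum_mul]
    ring

/-- Counting the lags (successor form): `Σ_{j<T+1} Σ_{i<j} c(j−i−1) = Σ_{r<T} (T−r)·c(r)`. [folklore] -/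
theorem sum_sum_lag_succ (c : ℕ → ℝ) (T : ℕ) :
    ∑ j ∈ Finset.range (T + 1), ∑ i ∈ Finset.range j, c (j - i - 1) =
      ∑ r ∈ Finset.range T, ((T : ℝ) - r) * c r := by
  induction T with
  | zero => simp
  | succ T ih =>
    rw [Finset.sum_range_succ, ih]
    have hre : ∑ i ∈ Finset.range (T + 1), c (T + 1 - i - 1) = ∑ r ∈ Finset.range (T + 1), c r := by
      rw [← Finset.sum_range_reflect c (T + 1)]
      refine Finset.sum_congr rfl fun i hi => ?_
      rw [Finset.mem_range] at hi
      congr 1; omega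
    rw [hre, Finset.sum_range_succ c, Finset.sum_range_succ (fun r => (((T + 1 : ℕ) : ℝ) - r) * c r)]
    have hsplit : ∑ r ∈ Finset.range T, (((T + 1 : ℕ) : ℝ) - r) * c r =
        ∑ r ∈ Finset.range T, ((T : ℝ) - r) * c r + ∑ r ∈ Finset.range T, c r := by
      rw [← Finset.sum_add_distrib]
      refine Finset.sum_congr rfl fun r _ => ?_
      push_cast; ring
    rw [hsplit]
    push_cast
    ring

/-- Counting the lags: `Σ_{j<T} Σ_{i<j} c(j−i−1) = Σ_{r<T−1} (T−1−r)·c(r)`. [folklore] -/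
theorem sum_sum_lag (c : ℕ → ℝ) (T : ℕ) :
    ∑ j ∈ Finset.range T, ∑ i ∈ Finset.range j, c (j - i - 1) =
      ∑ r ∈ Finset.range (T - 1), ((T : ℝ) - 1 - r) * c r := by
  rcases Nat.eq_zero_or_pos T with hT | hT
  · subst hT; simp
  · obtain ⟨m, rfl⟩ : ∃ m, T = m + 1 := ⟨T - 1, by omega⟩
    rw [sum_sum_lag_succ, Nat.add_sub_cancel]
    refine Finset.sum_congr rfl fun r _ => ?_
    push_cast; ring

/-- **Theorem A(i) — the variance identity** from the diagonal and cross stubs: pathwise telescoping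
`Ψ(X_T) − Ψ(X_0) = Σ_{i<T} (Ψ(X_{i+1}) − Ψ(X_i))`, square expansion, linearity of the path functional and of
the integral, and the lag count `Σ_{i<j<T} c_{j−i−1} = Σ_{r<T−1}(T−1−r)c_r`. -/
theorem varianceIdentity_of (hDG : Sig.stub_diagonalTerms) (hCR : Sig.stub_crossTerms) :
    Sig.stub_varianceIdentity := by
  intro sh hsh Pop hPop E hE0 hEs ψ B hψm hψB g hg T
  have hPFB := stub_pathFunctionalBasics E hE0 hEs
  set P := bondPercolation (zdGraph 3) (criticalProbI 3) with hPdef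
  set deg : BondConfig (Site 3) → ℝ := fun ω =>
    ((((zdGraph 3).neighborFinset (0 : Site 3)).filter (fun y => s((0 : Site 3), y) ∈ ω)).card : ℝ)
    with hdegdef
  have hdeg0 : ∀ ω, 0 ≤ deg ω := fun ω => Nat.cast_nonneg _
  have hdeg6 : ∀ ω, deg ω ≤ 6 := fun ω => DeterministicTime.deg_le_six ω 0
  have hdeg_meas : Measurable deg := StubStationarity.measurable_card_filter_zero
  have hB0 : 0 ≤ B := (abs_nonneg _).trans (hψB (∅ : Set (Sym2 (Site 3))))
  -- the corrector-shifted heights along a path and their increments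
  set A : BondConfig (Site 3) → List (Site 3) → ℕ → ℝ := fun ω l i =>
    (((l.getD i 0) 0 : ℤ) : ℝ) + ψ (sh (l.getD i 0) ω) with hAdef
  set μ : BondConfig (Site 3) → List (Site 3) → ℕ → ℝ := fun ω l i => A ω l (i + 1) - A ω l i
    with hμdef
  set c : ℕ → ℝ := fun r => ∫ ω in percolatesAt (0 : Site 3),
      deg ω * (g ω * ((Pop ω)^[r] (fun x => g (sh x ω))) 0) ∂P with hcdef
  set Fψ : ℝ := ∫ ω in percolatesAt (0 : Site 3),
      ∑ y ∈ ((zdGraph 3).neighborFinset (0 : Site 3)).filter (fun y => s((0 : Site 3), y) ∈ ω),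
        (((y 0 : ℤ) : ℝ) + ψ (sh y ω) - ψ ω) ^ 2 ∂P with hFψdef
  -- the stubs, termwise
  have hDi : ∀ i ∈ Finset.range T,
      ∫ ω in percolatesAt (0 : Site 3), deg ω * E ω T 0 (fun l => μ ω l i ^ 2) ∂P = Fψ := by
    intro i hi
    rw [Finset.mem_range] at hi
    exact hDG sh hsh Pop hPop E hE0 hEs ψ B hψm hψB T i hi
  have hCij : ∀ j ∈ Finset.range T, ∀ i ∈ Finset.range j,
      ∫ ω in percolatesAt (0 : Site 3), deg ω * E ω T 0 (fun l => μ ω l i * μ ω l j) ∂P =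
        -c (j - i - 1) := by
    intro j hj i hi
    rw [Finset.mem_range] at hi hj
    exact hCR sh hsh Pop hPop E hE0 hEs ψ B hψm hψB g hg T i j hi hj
  -- pathwise telescoping and square expansion, then linearity of `E`
  have hpath : ∀ ω (l : List (Site 3)),
      (A ω l T - A ω l 0) ^ 2 =
        ∑ i ∈ Finset.range T, μ ω l i ^ 2 +
          2 * ∑ j ∈ Finset.range T, ∑ i ∈ Finset.range j, μ ω l i * μ ω l j := by
    intro ω l
    rw [← Finset.sum_range_sub (A ω l) T]
    exact sq_sum_range _ _
  have hlinE : ∀ ω, E ω T 0 (fun l => (A ω l T - A ω l 0) ^ 2) =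
      ∑ i ∈ Finset.range T, E ω T 0 (fun l => μ ω l i ^ 2) +
        2 * ∑ j ∈ Finset.range T, ∑ i ∈ Finset.range j, E ω T 0 (fun l => μ ω l i * μ ω l j) := by
    intro ω
    have hlin := (hPFB ω T 0).2.1
    simp only [hpath]
    rw [show (fun l => ∑ i ∈ Finset.range T, μ ω l i ^ 2 +
        2 * ∑ j ∈ Finset.range T, ∑ i ∈ Finset.range j, μ ω l i * μ ω l j) =
        fun l => 1 * (∑ i ∈ Finset.range T, μ ω l i ^ 2) +
          2 * (∑ j ∈ Finset.range T, ∑ i ∈ Finset.range j, μ ω l i * μ ω l j) from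
        funext fun l => by ring, hlin, one_mul]
    rw [StubPathReversal.finset_sum (hE0 ω) (hEs ω) (Finset.range T) T 0 (fun i l => μ ω l i ^ 2),
      StubPathReversal.finset_sum (hE0 ω) (hEs ω) (Finset.range T) T 0
        (fun j l => ∑ i ∈ Finset.range j, μ ω l i * μ ω l j)]
    congr 1
    refine congrArg (2 * ·) (Finset.sum_congr rfl fun j _ => ?_)
    exact StubPathReversal.finset_sum (hE0 ω) (hEs ω) (Finset.range j) T 0 (fun i l => μ ω l i * μ ω l j)
  -- integrability of every term: `|E ω T 0 (μ_i μ_j)| ≤ (1 + 2B)²` (the functional only sees lattice chains)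
  have hμb : ∀ ω (l : List (Site 3)), l.length = T + 1 → l.getD 0 0 = 0 →
      (∀ i < T, l.getD (i + 1) 0 ∈
        ((zdGraph 3).neighborFinset (l.getD i 0)).filter (fun y => s(l.getD i 0, y) ∈ ω)) →
      ∀ i < T, |μ ω l i| ≤ 1 + 2 * B := by
    intro ω l _ _ hc i hi
    have hadj : (zdGraph 3).Adj (l.getD i 0) (l.getD (i + 1) 0) :=
      (SimpleGraph.mem_neighborFinset _ _ _).mp (Finset.mem_filter.mp (hc i hi)).1
    have h1 := SlabVoltage.apply_zero_le_of_adj hadj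
    have h2 := SlabVoltage.apply_zero_le_of_adj hadj.symm
    have hd : |((((l.getD (i + 1) 0) 0 : ℤ) : ℝ)) - (((l.getD i 0) 0 : ℤ) : ℝ)| ≤ 1 := by
      rw [abs_le]; constructor
      · have : (l.getD i 0) 0 - 1 ≤ (l.getD (i + 1) 0) 0 := by omega
        have := (Int.cast_le (R := ℝ)).2 this; push_cast at this; linarith
      · have := (Int.cast_le (R := ℝ)).2 h1; push_cast at this; linarith
    have hb1 := hψB (sh (l.getD (i + 1) 0) ω)
    have hb2 := hψB (sh (l.getD i 0) ω)
    rw [abs_le] at hd hb1 hb2 ⊢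
    simp only [hμdef, hAdef]
    constructor <;> linarith [hd.1, hd.2, hb1.1, hb1.2, hb2.1, hb2.2]
  have hEabs : ∀ ω (G : List (Site 3) → ℝ) (M : ℝ), 0 ≤ M →
      (∀ l : List (Site 3), l.length = T + 1 → l.getD 0 0 = 0 →
        (∀ i < T, l.getD (i + 1) 0 ∈
          ((zdGraph 3).neighborFinset (l.getD i 0)).filter (fun y => s(l.getD i 0, y) ∈ ω)) →
        |G l| ≤ M) → |E ω T 0 G| ≤ M := by
    intro ω G M hM hG
    have hmass := (hPFB ω T 0).2.2.2.1
    have hlin := (hPFB ω T 0).2.1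
    have up : E ω T 0 G ≤ M := by
      calc E ω T 0 G ≤ E ω T 0 (fun _ => M * 1) :=
            StubFourthMoment.mono_chain (v₀ := (0 : Site 3))
              (N := fun z => ((zdGraph 3).neighborFinset z).filter (fun y => s(z, y) ∈ ω))
              (hE0 ω) (hEs ω) T 0 fun l hl hl0 hc => by
                rw [mul_one]; exact (le_abs_self _).trans (hG l hl hl0 hc)
        _ = M * E ω T 0 (fun _ => (1 : ℝ)) := by
            have := hlin (fun _ => (1 : ℝ)) (fun _ => (1 : ℝ)) M 0
            simp only [zero_mul, add_zero] at this; exact this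
        _ ≤ M := mul_le_of_le_one_right hM hmass
    have dn : -E ω T 0 G ≤ M := by
      have hneg : E ω T 0 (fun l => (-1) * G l + 0 * G l) = (-1) * E ω T 0 G + 0 * E ω T 0 G :=
        hlin G G (-1) 0
      simp only [zero_mul, add_zero, neg_one_mul] at hneg
      rw [← hneg]
      calc E ω T 0 (fun l => -G l) ≤ E ω T 0 (fun _ => M * 1) :=
            StubFourthMoment.mono_chain (v₀ := (0 : Site 3))
              (N := fun z => ((zdGraph 3).neighborFinset z).filter (fun y => s(z, y) ∈ ω))
              (hE0 ω) (hEs ω) T 0 fun l hl hl0 hc => by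
                rw [mul_one]; exact (neg_le_abs _).trans (hG l hl hl0 hc)
        _ = M * E ω T 0 (fun _ => (1 : ℝ)) := by
            have := hlin (fun _ => (1 : ℝ)) (fun _ => (1 : ℝ)) M 0
            simp only [zero_mul, add_zero] at this; exact this
        _ ≤ M := mul_le_of_le_one_right hM hmass
    exact abs_le.2 ⟨by linarith, up⟩
  have hshm : ∀ z : Site 3, Measurable fun ω => ψ (sh z ω) := fun z => by
    have : (fun ω => ψ (sh z ω)) = fun ω => ψ (BondConfig.relabel (sym2Equiv (Site.shift (-z))) ω) :=
      funext fun ω => by rw [hsh]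
    rw [this]; exact hψm.comp (BondConfig.relabel _).measurable
  have hμm : ∀ (l : List (Site 3)) (i : ℕ), Measurable fun ω => μ ω l i := fun l i => by
    simp only [hμdef, hAdef]
    exact (measurable_const.add (hshm _)).sub (measurable_const.add (hshm _))
  have hint : ∀ i < T, ∀ j < T,
      Integrable (fun ω => deg ω * E ω T 0 (fun l => μ ω l i * μ ω l j)) P := by
    intro i hi j hj
    refine Integrable.of_bound ((hdeg_meas.mul (StubPathReversal.measurable_E hE0 hEs T 0
      (G := fun ω l => μ ω l i * μ ω l j) fun l => (hμm l i).mul (hμm l j))).aestronglyMeasurable)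
      (6 * (1 + 2 * B) ^ 2) (Eventually.of_forall fun ω => ?_)
    rw [Real.norm_eq_abs, abs_mul, abs_of_nonneg (hdeg0 ω)]
    refine mul_le_mul (hdeg6 ω) (hEabs ω _ _ (by positivity) fun l hl hl0 hc => ?_) (abs_nonneg _)
      (by norm_num)
    rw [abs_mul, sq]
    exact mul_le_mul (hμb ω l hl hl0 hc i hi) (hμb ω l hl hl0 hc j hj) (abs_nonneg _) (by linarith)
  -- integrate the expansion
  have hI : ∫ ω in percolatesAt (0 : Site 3), deg ω * E ω T 0 (fun l => (A ω l T - A ω l 0) ^ 2) ∂P =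
      (T : ℝ) * Fψ - 2 * ∑ j ∈ Finset.range T, ∑ i ∈ Finset.range j, c (j - i - 1) := by
    have e1 : (fun ω => deg ω * E ω T 0 (fun l => (A ω l T - A ω l 0) ^ 2)) = fun ω =>
        ∑ i ∈ Finset.range T, deg ω * E ω T 0 (fun l => μ ω l i ^ 2) +
          2 * ∑ j ∈ Finset.range T, ∑ i ∈ Finset.range j,
            deg ω * E ω T 0 (fun l => μ ω l i * μ ω l j) := by
      funext ω; rw [hlinE ω, mul_add, Finset.mul_sum, mul_left_comm, Finset.mul_sum]
      simp only [Finset.mul_sum]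
    have iD : ∀ i ∈ Finset.range T,
        Integrable (fun ω => deg ω * E ω T 0 (fun l => μ ω l i ^ 2)) P := by
      intro i hi; rw [Finset.mem_range] at hi
      have := hint i hi i hi; simp only [← sq] at this; exact this
    have iC : ∀ j ∈ Finset.range T, Integrable (fun ω => ∑ i ∈ Finset.range j,
        deg ω * E ω T 0 (fun l => μ ω l i * μ ω l j)) P := by
      intro j hj; rw [Finset.mem_range] at hj
      refine integrable_finset_sum _ fun i hi => ?_
      rw [Finset.mem_range] at hi
      exact hint i (hi.trans hj) j hj
    rw [e1, integral_add (integrable_finset_sum _ iD).integrableOn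
        ((integrable_finset_sum _ iC).const_mul 2).integrableOn,
      integral_const_mul, integral_finset_sum _ fun i hi => (iD i hi).integrableOn,
      integral_finset_sum _ fun j hj => (iC j hj).integrableOn]
    have hC : ∀ j ∈ Finset.range T,
        ∫ ω in percolatesAt (0 : Site 3), ∑ i ∈ Finset.range j,
            deg ω * E ω T 0 (fun l => μ ω l i * μ ω l j) ∂P = -∑ i ∈ Finset.range j, c (j - i - 1) := by
      intro j hj
      rw [integral_finset_sum _ fun i hi => ?_, Finset.sum_congr rfl (hCij j hj), Finset.sum_neg_distrib]
      rw [Finset.mem_range] at hi hj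
      exact (hint i (hi.trans hj) j hj).integrableOn
    rw [Finset.sum_congr rfl hDi, Finset.sum_const, Finset.card_range, nsmul_eq_mul,
      Finset.sum_congr rfl hC, Finset.sum_neg_distrib]
    ring
  -- conclude with the lag count
  have hgoal : (∫ ω in percolatesAt (0 : Site 3), deg ω * E ω T 0 (fun l => (A ω l T - A ω l 0) ^ 2) ∂P) +
      2 * ∑ r ∈ Finset.range (T - 1), ((T : ℝ) - 1 - r) * c r = (T : ℝ) * Fψ := by
    rw [hI, ← sum_sum_lag c T]; ring
  simpa only [hAdef, hcdef, hFψdef] using hgoal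

/-- **Theorem A(iii) — the test-function second-moment bound.**  For every bounded measurable `ψ`
(`|ψ| ≤ B`) and every `T`:
`∫_{0↔∞} deg·(𝒫^T h²)(0) dP ≤ 2T·F̃(ψ) + 48 B²`, `F̃(ψ) = ∫_{0↔∞} Σ_{y∈N_ω(0)} (y₀ + ψ(ω−y) − ψ(ω))² dP`.
From `stub_varianceIdentity` + `stub_toeplitzPositivity` (so `E_ann[(ΔΨ)²] ≤ T·F̃`) and the pathwise
`h(X_T)² ≤ 2(ΔΨ)² + 8B²` (`h(X_T) = ΔΨ − Δψ`, `X_0 = 0`). -/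
theorem secondMoment_le (hVI : Sig.stub_varianceIdentity) (hTP : Sig.stub_toeplitzPositivity)
    {ψ : BondConfig (Site 3) → ℝ} {B : ℝ} (hψm : Measurable ψ) (hψB : ∀ ω, |ψ ω| ≤ B) (T : ℕ)
    {Pop : BondConfig (Site 3) → (Site 3 → ℝ) → Site 3 → ℝ}
    (hPop : ∀ ω (g : Site 3 → ℝ) (x : Site 3), Pop ω g x =
      (∑ y ∈ ((zdGraph 3).neighborFinset x).filter (fun y => s(x, y) ∈ ω), g y) /
        ((((zdGraph 3).neighborFinset x).filter (fun y => s(x, y) ∈ ω)).card : ℝ)) :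
    ∫ ω in percolatesAt (0 : Site 3),
        ((((zdGraph 3).neighborFinset (0 : Site 3)).filter
            (fun y => s((0 : Site 3), y) ∈ ω)).card : ℝ) *
          ((Pop ω)^[T] (fun x => ((x 0 : ℤ) : ℝ) ^ 2)) 0
        ∂(bondPercolation (zdGraph 3) (criticalProbI 3)) ≤
      2 * (T : ℝ) * ∫ ω in percolatesAt (0 : Site 3),
          ∑ y ∈ ((zdGraph 3).neighborFinset (0 : Site 3)).filter (fun y => s((0 : Site 3), y) ∈ ω),
            (((y 0 : ℤ) : ℝ) + ψ (BondConfig.relabel (sym2Equiv (Site.shift (-y))) ω) - ψ ω) ^ 2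
          ∂(bondPercolation (zdGraph 3) (criticalProbI 3)) + 48 * B ^ 2 := by
  -- the pinned objects
  obtain ⟨sh, hsh⟩ : ∃ sh : Site 3 → BondConfig (Site 3) → BondConfig (Site 3),
      ∀ (x : Site 3) (ω : BondConfig (Site 3)),
        sh x ω = BondConfig.relabel (sym2Equiv (Site.shift (-x))) ω := ⟨_, fun _ _ => rfl⟩
  obtain ⟨E, hE0, hEs⟩ : ∃ E : BondConfig (Site 3) → ℕ → Site 3 → (List (Site 3) → ℝ) → ℝ,
      (∀ ω (x : Site 3) (G : List (Site 3) → ℝ), E ω 0 x G = G [x]) ∧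
      (∀ ω (T : ℕ) (x : Site 3) (G : List (Site 3) → ℝ), E ω (T + 1) x G =
        (∑ y ∈ ((zdGraph 3).neighborFinset x).filter (fun y => s(x, y) ∈ ω),
            E ω T y (fun l => G (x :: l))) /
          ((((zdGraph 3).neighborFinset x).filter (fun y => s(x, y) ∈ ω)).card : ℝ)) :=
    ⟨fun ω T => Nat.rec (motive := fun _ => Site 3 → (List (Site 3) → ℝ) → ℝ) (fun x G => G [x])
      (fun _ ih x G => (∑ y ∈ ((zdGraph 3).neighborFinset x).filter (fun y => s(x, y) ∈ ω),
        ih y (fun l => G (x :: l))) /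
          ((((zdGraph 3).neighborFinset x).filter (fun y => s(x, y) ∈ ω)).card : ℝ)) T,
      fun _ _ _ => rfl, fun _ _ _ _ => rfl⟩
  obtain ⟨g, hg⟩ : ∃ g : BondConfig (Site 3) → ℝ,
      ∀ ω, g ω = Pop ω (fun y => ((y 0 : ℤ) : ℝ) + ψ (sh y ω) - ψ ω) 0 := ⟨_, fun _ => rfl⟩
  have hPFB := stub_pathFunctionalBasics E hE0 hEs
  set P := bondPercolation (zdGraph 3) (criticalProbI 3) with hPdef
  set deg : BondConfig (Site 3) → ℝ := fun ω =>
    ((((zdGraph 3).neighborFinset (0 : Site 3)).filter (fun y => s((0 : Site 3), y) ∈ ω)).card : ℝ)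
    with hdegdef
  have hdeg0 : ∀ ω, 0 ≤ deg ω := fun ω => Nat.cast_nonneg _
  have hdeg6 : ∀ ω, deg ω ≤ 6 := fun ω => DeterministicTime.deg_le_six ω 0
  have hdeg_meas : Measurable deg := StubStationarity.measurable_card_filter_zero
  have hB0 : 0 ≤ B := (abs_nonneg _).trans (hψB (∅ : Set (Sym2 (Site 3))))
  -- the functional `ΔΨ²` and its annealed expectation `I`
  set Gψ : BondConfig (Site 3) → List (Site 3) → ℝ := fun ω l =>
    ((((l.getD T 0) 0 : ℤ) : ℝ) + ψ (sh (l.getD T 0) ω) -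
      ((((l.getD 0 0) 0 : ℤ) : ℝ) + ψ (sh (l.getD 0 0) ω))) ^ 2 with hGψdef
  set Fψ : ℝ := ∫ ω in percolatesAt (0 : Site 3),
      ∑ y ∈ ((zdGraph 3).neighborFinset (0 : Site 3)).filter (fun y => s((0 : Site 3), y) ∈ ω),
        (((y 0 : ℤ) : ℝ) + ψ (sh y ω) - ψ ω) ^ 2 ∂P with hFψdef
  have hF : (∫ ω in percolatesAt (0 : Site 3),
      ∑ y ∈ ((zdGraph 3).neighborFinset (0 : Site 3)).filter (fun y => s((0 : Site 3), y) ∈ ω),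
        (((y 0 : ℤ) : ℝ) + ψ (BondConfig.relabel (sym2Equiv (Site.shift (-y))) ω) - ψ ω) ^ 2 ∂P) = Fψ := by
    simp only [hFψdef, hsh]
  rw [hF]
  set I : ℝ := ∫ ω in percolatesAt (0 : Site 3), deg ω * E ω T 0 (Gψ ω) ∂P with hIdef
  set Pt : ℝ := ∑ r ∈ Finset.range (T - 1), ((T : ℝ) - 1 - r) *
      ∫ ω in percolatesAt (0 : Site 3), deg ω * (g ω * ((Pop ω)^[r] (fun x => g (sh x ω))) 0) ∂P
    with hPtdef
  -- (1) the variance identity and Toeplitz positivity: `I ≤ T·F̃`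
  have hId : I + 2 * Pt = (T : ℝ) * Fψ := hVI sh hsh Pop hPop E hE0 hEs ψ B hψm hψB g hg T
  have hgm : Measurable g := by
    have : g = fun ω => (∑ y ∈ (zdGraph 3).neighborFinset (0 : Site 3),
        if s((0 : Site 3), y) ∈ ω then (((y 0 : ℤ) : ℝ) + ψ (sh y ω) - ψ ω) else 0) / deg ω := by
      funext ω; rw [hg, hPop, Finset.sum_filter]
    rw [this]
    refine Measurable.div (Finset.measurable_sum _ fun y _ => ?_) hdeg_meas
    refine Measurable.ite (measurableSet_mem (s((0 : Site 3), y) : Sym2 (Site 3))) ?_ measurable_const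
    have hshm : Measurable fun ω => ψ (sh y ω) := by
      have : (fun ω => ψ (sh y ω)) = fun ω => ψ (BondConfig.relabel (sym2Equiv (Site.shift (-y))) ω) :=
        funext fun ω => by rw [hsh]
      rw [this]
      exact hψm.comp (BondConfig.relabel (sym2Equiv (Site.shift (-y)))).measurable
    exact (measurable_const.add hshm).sub hψm
  have hgB : ∀ ω, |g ω| ≤ 1 + 2 * B := by
    intro ω
    rw [hg, hPop]
    refine abs_avg_le _ _ (by linarith) fun y hy => ?_
    rw [Finset.mem_filter] at hy
    have h1 := abs_height_le_one_of_mem hy.1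
    have h2 := hψB (sh y ω)
    have h3 := hψB ω
    calc |((y 0 : ℤ) : ℝ) + ψ (sh y ω) - ψ ω|
        ≤ |((y 0 : ℤ) : ℝ) + ψ (sh y ω)| + |ψ ω| := abs_sub _ _
      _ ≤ |((y 0 : ℤ) : ℝ)| + |ψ (sh y ω)| + |ψ ω| := by linarith [abs_add_le ((y 0 : ℤ) : ℝ) (ψ (sh y ω))]
      _ ≤ 1 + 2 * B := by linarith
  have hPt : 0 ≤ Pt := by
    rcases lt_or_ge T 2 with hT | hT
    · have : T - 1 = 0 := by omega
      rw [hPtdef, this, Finset.range_zero, Finset.sum_empty]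
    · have h := hTP sh hsh Pop hPop g (1 + 2 * B) hgm hgB (T - 2)
      have e1 : T - 2 + 1 = T - 1 := by omega
      have e2 : ((T - 2 : ℕ) : ℝ) + 1 = (T : ℝ) - 1 := by
        rw [Nat.cast_sub hT]; push_cast; ring
      rw [e1] at h
      simp only [e2] at h
      exact h
  have hI : I ≤ (T : ℝ) * Fψ := by linarith
  -- (2) pathwise: `h(X_T)² ≤ 2 ΔΨ² + 8 B²` on paths from `0`, hence `deg·E[h²] ≤ 2 deg·E[ΔΨ²] + 48 B²`
  have hsh0 : ∀ ω, sh 0 ω = ω := fun ω => by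
    rw [hsh]; exact StubStationarity.relabel_shift_neg_zero ω
  have k : ∀ ω, deg ω * ((Pop ω)^[T] (fun x => ((x 0 : ℤ) : ℝ) ^ 2)) 0 ≤
      2 * (deg ω * E ω T 0 (Gψ ω)) + 48 * B ^ 2 := by
    intro ω
    have hmono := (hPFB ω T 0).1
    have hlin := (hPFB ω T 0).2.1
    have hmass := (hPFB ω T 0).2.2.2.1
    have hcongr := (hPFB ω T 0).2.2.2.2.2.1
    have hlink := (hPFB ω T 0).2.2.2.2.2.2.1 Pop hPop (fun x => ((x 0 : ℤ) : ℝ) ^ 2)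
    rw [hlink]
    have h1 : E ω T 0 (fun l => (((l.getD T 0) 0 : ℤ) : ℝ) ^ 2) =
        E ω T 0 (fun l => if l.getD 0 0 = 0 then (((l.getD T 0) 0 : ℤ) : ℝ) ^ 2 else 0) :=
      hcongr _ _ fun l _ hl0 => by rw [if_pos hl0]
    have h2 : E ω T 0 (fun l => if l.getD 0 0 = 0 then (((l.getD T 0) 0 : ℤ) : ℝ) ^ 2 else 0) ≤
        E ω T 0 (fun l => 2 * Gψ ω l + 8 * B ^ 2 * 1) := by
      refine hmono _ _ fun l => ?_
      split_ifs with hl0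
      · have hval : Gψ ω l = ((((l.getD T 0) 0 : ℤ) : ℝ) + ψ (sh (l.getD T 0) ω) - ψ ω) ^ 2 := by
          simp only [hGψdef, hl0, hsh0, Pi.zero_apply, Int.cast_zero, zero_add]
        rw [hval]
        have hb : |ψ (sh (l.getD T 0) ω) - ψ ω| ≤ 2 * B := by
          calc |ψ (sh (l.getD T 0) ω) - ψ ω| ≤ |ψ (sh (l.getD T 0) ω)| + |ψ ω| := abs_sub _ _
            _ ≤ 2 * B := by linarith [hψB (sh (l.getD T 0) ω), hψB ω]
        have hsq : (ψ (sh (l.getD T 0) ω) - ψ ω) ^ 2 ≤ (2 * B) ^ 2 := by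
          rw [← sq_abs]; exact pow_le_pow_left₀ (abs_nonneg _) hb 2
        nlinarith [hsq, sq_nonneg ((((l.getD T 0) 0 : ℤ) : ℝ) + 2 * (ψ (sh (l.getD T 0) ω) - ψ ω))]
      · nlinarith [sq_nonneg (((((l.getD T 0) 0 : ℤ) : ℝ) + ψ (sh (l.getD T 0) ω) -
          ((((l.getD 0 0) 0 : ℤ) : ℝ) + ψ (sh (l.getD 0 0) ω)))), sq_nonneg B]
    have h3 : E ω T 0 (fun l => 2 * Gψ ω l + 8 * B ^ 2 * 1) =
        2 * E ω T 0 (Gψ ω) + 8 * B ^ 2 * E ω T 0 (fun _ => (1 : ℝ)) := hlin _ _ _ _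
    have h4 : E ω T 0 (fun l => (((l.getD T 0) 0 : ℤ) : ℝ) ^ 2) ≤ 2 * E ω T 0 (Gψ ω) + 8 * B ^ 2 := by
      rw [h1]; refine h2.trans ?_; rw [h3]; nlinarith [hmass, sq_nonneg B]
    have h5 := mul_le_mul_of_nonneg_left h4 (hdeg0 ω)
    nlinarith [hdeg6 ω, hdeg0 ω, sq_nonneg B]
  -- (3) integrability and integration
  have hGm : ∀ l, Measurable fun ω => Gψ ω l := by
    intro l
    simp only [hGψdef, hsh]
    exact (((measurable_const.add (hψm.comp (BondConfig.relabel _).measurable)).sub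
      (measurable_const.add (hψm.comp (BondConfig.relabel _).measurable))).pow_const 2)
  have hEb : ∀ ω, 0 ≤ E ω T 0 (Gψ ω) ∧ E ω T 0 (Gψ ω) ≤ ((T : ℝ) + 2 * B) ^ 2 := by
    intro ω
    refine ⟨(hPFB ω T 0).2.2.1 _ fun l => by rw [hGψdef]; positivity, ?_⟩
    have hmass := (hPFB ω T 0).2.2.2.1
    have hlin := (hPFB ω T 0).2.1
    calc E ω T 0 (Gψ ω) ≤ E ω T 0 (fun _ => ((T : ℝ) + 2 * B) ^ 2 * 1) := by
          refine StubFourthMoment.mono_chain (v₀ := (0 : Site 3))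
            (N := fun z => ((zdGraph 3).neighborFinset z).filter (fun y => s(z, y) ∈ ω))
            (hE0 ω) (hEs ω) T 0 fun l hl hl0 hc => ?_
          rw [hGψdef]; simp only [hl0, hsh0, mul_one]
          obtain ⟨hA, hB'⟩ := StubFourthMoment.height_le_of_chain ω hc T le_rfl
          rw [hl0] at hA hB'
          have a1 : (((l.getD T 0) 0 : ℤ) : ℝ) ≤ T := by
            have : (l.getD T 0) 0 ≤ (T : ℤ) := by simpa using hA
            exact_mod_cast this
          have a2 : -(T : ℝ) ≤ (((l.getD T 0) 0 : ℤ) : ℝ) := by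
            have : -(T : ℤ) ≤ (l.getD T 0) 0 := by
              have := hB'; simp only [Pi.zero_apply] at this; omega
            exact_mod_cast this
          have hb1 := hψB (sh (l.getD T 0) ω)
          have hb2 := hψB ω
          rw [abs_le] at hb1 hb2
          have habs : |(((l.getD T 0) 0 : ℤ) : ℝ) + ψ (sh (l.getD T 0) ω) -
              ((((0 : Site 3) 0 : ℤ) : ℝ) + ψ ω)| ≤ (T : ℝ) + 2 * B := by
            rw [abs_le]; simp only [Pi.zero_apply, Int.cast_zero, zero_add]
            constructor <;> linarith
          calc ((((l.getD T 0) 0 : ℤ) : ℝ) + ψ (sh (l.getD T 0) ω) -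
                ((((0 : Site 3) 0 : ℤ) : ℝ) + ψ ω)) ^ 2
              = |(((l.getD T 0) 0 : ℤ) : ℝ) + ψ (sh (l.getD T 0) ω) -
                  ((((0 : Site 3) 0 : ℤ) : ℝ) + ψ ω)| ^ 2 := (sq_abs _).symm
            _ ≤ ((T : ℝ) + 2 * B) ^ 2 := pow_le_pow_left₀ (abs_nonneg _) habs 2
      _ = ((T : ℝ) + 2 * B) ^ 2 * E ω T 0 (fun _ => (1 : ℝ)) := by
          have := hlin (fun _ => (1 : ℝ)) (fun _ => (1 : ℝ)) (((T : ℝ) + 2 * B) ^ 2) 0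
          simp only [zero_mul, add_zero] at this
          exact this
      _ ≤ ((T : ℝ) + 2 * B) ^ 2 := mul_le_of_le_one_right (sq_nonneg _) hmass
  have iI : Integrable (fun ω => deg ω * E ω T 0 (Gψ ω)) P := by
    refine Integrable.of_bound ((hdeg_meas.mul (StubPathReversal.measurable_E hE0 hEs T 0 hGm))
      |>.aestronglyMeasurable) (6 * ((T : ℝ) + 2 * B) ^ 2) (Eventually.of_forall fun ω => ?_)
    rw [Real.norm_eq_abs, abs_of_nonneg (mul_nonneg (hdeg0 ω) (hEb ω).1)]
    exact mul_le_mul (hdeg6 ω) (hEb ω).2 (hEb ω).1 (by norm_num)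
  have iR : Integrable (fun ω => 2 * (deg ω * E ω T 0 (Gψ ω)) + 48 * B ^ 2) P :=
    (iI.const_mul 2).add (integrable_const _)
  have hLnn : ∀ ω, 0 ≤ deg ω * ((Pop ω)^[T] (fun x => ((x 0 : ℤ) : ℝ) ^ 2)) 0 := fun ω =>
    mul_nonneg (hdeg0 ω) (Diffusivity.full_iterate_nonneg (hPop ω) T (fun x => sq_nonneg _) 0)
  calc ∫ ω in percolatesAt (0 : Site 3), deg ω * ((Pop ω)^[T] (fun x => ((x 0 : ℤ) : ℝ) ^ 2)) 0 ∂P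
      ≤ ∫ ω in percolatesAt (0 : Site 3), (2 * (deg ω * E ω T 0 (Gψ ω)) + 48 * B ^ 2) ∂P :=
        integral_mono_of_nonneg (Eventually.of_forall hLnn) iR.integrableOn (Eventually.of_forall k)
    _ = 2 * I + P.real (percolatesAt (0 : Site 3)) * (48 * B ^ 2) := by
        rw [integral_add (iI.const_mul 2).integrableOn (integrable_const _).integrableOn,
          integral_const_mul, setIntegral_const, smul_eq_mul, hIdef]
    _ ≤ 2 * ((T : ℝ) * Fψ) + 1 * (48 * B ^ 2) := by
        gcongr
        · exact measureReal_le_one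
    _ = 2 * (T : ℝ) * Fψ + 48 * B ^ 2 := by ring

/-- **Theorem C — SRW on the open cluster of the origin is subdiffusive at `p_c`, in the degree-biased
annealed sense restricted to `{0 ↔ ∞}`** (unconditional; void when `θ(p_c) = 0`): for every `σ > 0`,
eventually `∫_{0↔∞} deg·(𝒫^T h²)(0) dP < σ·T`.  From the three B-stubs (zero mean flux ⇒ correctors of
small Dirichlet energy) and Theorem A(iii). -/
theorem subdiffusive (hDG : Sig.stub_diagonalTerms) (hCR : Sig.stub_crossTerms)
    (hTP : Sig.stub_toeplitzPositivity)
    (hKW : Sig.stub_kirchhoffOfWeak) (hZF : Sig.stub_zeroMeanFlux) (hCA : Sig.stub_correctorApprox)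
    (σ : ℝ) (hσ : 0 < σ) :
    ∃ T₁ : ℕ, ∀ T ≥ T₁,
      ∀ Pop : BondConfig (Site 3) → (Site 3 → ℝ) → Site 3 → ℝ,
        (∀ ω (g : Site 3 → ℝ) (x : Site 3), Pop ω g x =
          (∑ y ∈ ((zdGraph 3).neighborFinset x).filter (fun y => s(x, y) ∈ ω), g y) /
            ((((zdGraph 3).neighborFinset x).filter (fun y => s(x, y) ∈ ω)).card : ℝ)) →
        ∫ ω in percolatesAt (0 : Site 3),
            ((((zdGraph 3).neighborFinset (0 : Site 3)).filter
                (fun y => s((0 : Site 3), y) ∈ ω)).card : ℝ) *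
              ((Pop ω)^[T] (fun x => ((x 0 : ℤ) : ℝ) ^ 2)) 0
            ∂(bondPercolation (zdGraph 3) (criticalProbI 3)) < σ * (T : ℝ) := by
  obtain ⟨sh, hsh⟩ : ∃ sh : Site 3 → BondConfig (Site 3) → BondConfig (Site 3),
      ∀ (x : Site 3) (ω : BondConfig (Site 3)),
        sh x ω = BondConfig.relabel (sym2Equiv (Site.shift (-x))) ω := ⟨_, fun _ _ => rfl⟩
  have hflux := fun θ hθm hθi hweak => hZF sh hsh θ hθm hθi (hKW sh hsh θ hθm hθi hweak)
  obtain ⟨ψ, B, hψm, hψB, hF⟩ := hCA sh hsh hflux (σ / 4) (by positivity)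
  simp only [hsh] at hF
  refine ⟨⌈96 * B ^ 2 / σ⌉₊ + 1, fun T hT Pop hPop => ?_⟩
  have hA := secondMoment_le (varianceIdentity_of hDG hCR) hTP hψm hψB T hPop
  have hT' : 96 * B ^ 2 / σ < T := by
    have h1 := Nat.lt_of_ceil_lt (show ⌈96 * B ^ 2 / σ⌉₊ < T by omega)
    exact h1
  have hT'' : 96 * B ^ 2 < σ * T := by
    rw [div_lt_iff₀ hσ] at hT'; linarith
  have hTpos : (0 : ℝ) < T := by exact_mod_cast (show 0 < T by omega)
  have hFnn : 0 ≤ ∫ ω in percolatesAt (0 : Site 3),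
      ∑ y ∈ ((zdGraph 3).neighborFinset (0 : Site 3)).filter (fun y => s((0 : Site 3), y) ∈ ω),
        (((y 0 : ℤ) : ℝ) + ψ (BondConfig.relabel (sym2Equiv (Site.shift (-y))) ω) - ψ ω) ^ 2
      ∂(bondPercolation (zdGraph 3) (criticalProbI 3)) :=
    setIntegral_nonneg (measurableSet_percolatesAt_holds (0 : Site 3)) fun ω _ =>
      Finset.sum_nonneg fun y _ => sq_nonneg _
  nlinarith [hA, hF, hT'', hTpos, mul_lt_mul_of_pos_left hF hTpos]

/-- The explicit averaging operator (to instantiate the `∀ Pop` statements). [folklore] -/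
theorem exists_pop :
    ∃ Pop : BondConfig (Site 3) → (Site 3 → ℝ) → Site 3 → ℝ,
      ∀ ω (g : Site 3 → ℝ) (x : Site 3), Pop ω g x =
        (∑ y ∈ ((zdGraph 3).neighborFinset x).filter (fun y => s(x, y) ∈ ω), g y) /
          ((((zdGraph 3).neighborFinset x).filter (fun y => s(x, y) ∈ ω)).card : ℝ) :=
  ⟨_, fun _ _ _ => rfl⟩

/-- **Corollary C1 — rev 9's open stub DIFF is SUMMIT-EQUIVALENT**: positive annealed diffusivity of the
walk on the would-be critical infinite cluster holds iff `θ(p_c) = 0` (→: in the jump world it contradicts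
Theorem C; ←: vacuous). -/
theorem stub_diffusivity_iff_continuity (hDG : Sig.stub_diagonalTerms) (hCR : Sig.stub_crossTerms)
    (hTP : Sig.stub_toeplitzPositivity) (hKW : Sig.stub_kirchhoffOfWeak) (hZF : Sig.stub_zeroMeanFlux)
    (hCA : Sig.stub_correctorApprox) : Sig.stub_diffusivity ↔ _root_.PercolationContinuityZ3 := by
  show _ ↔ Literature.Probability.Percolation.PercolationContinuityZ3
  rw [percolationContinuityZ3_iff]
  constructor
  · intro hD
    by_contra hne
    have hθ : 0 < theta (zdGraph 3) (0 : Site 3) (criticalProbI 3) :=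
      lt_of_le_of_ne measureReal_nonneg (Ne.symm hne)
    obtain ⟨σ, hσ, T₀, hT₀⟩ := hD hθ
    obtain ⟨T₁, hT₁⟩ := subdiffusive hDG hCR hTP hKW hZF hCA σ hσ
    obtain ⟨Pop, hPop⟩ := exists_pop
    have h1 := hT₀ (max T₀ T₁) (le_max_left _ _) Pop hPop
    have h2 := hT₁ (max T₀ T₁) (le_max_right _ _) Pop hPop
    exact (lt_irrefl _) (h1.trans_lt h2)
  · intro h0 hθ
    rw [h0] at hθ
    exact absurd hθ (lt_irrefl 0)

/-- **Corollary C2 — rev 8's AC is SUMMIT-EQUIVALENT**: anti-concentration of the walk at a deterministic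
time of diffusive order holds iff `θ(p_c) = 0` (→: Chebyshev `∫_C (𝒫^T 1_{n≤x₀})(0) ≤ Λ_T(h²)/n²`, `deg ≥ 1`
a.s. on `{0↔∞}`, Theorem A(iii) with a corrector chosen AFTER `K`, and `T ≤ c(Kn)²`; ←: vacuous). -/
theorem stub_antiConcentration_iff_continuity (hDG : Sig.stub_diagonalTerms)
    (hCR : Sig.stub_crossTerms) (hTP : Sig.stub_toeplitzPositivity) (hKW : Sig.stub_kirchhoffOfWeak) (hZF : Sig.stub_zeroMeanFlux)
    (hCA : Sig.stub_correctorApprox) : Sig.stub_antiConcentration ↔ _root_.PercolationContinuityZ3 := by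
  show _ ↔ Literature.Probability.Percolation.PercolationContinuityZ3
  rw [percolationContinuityZ3_iff]
  constructor
  · intro hAC
    by_contra hne
    have hθ : 0 < theta (zdGraph 3) (0 : Site 3) (criticalProbI 3) :=
      lt_of_le_of_ne measureReal_nonneg (Ne.symm hne)
    obtain ⟨c, hc, hAC'⟩ := hAC hθ
    obtain ⟨K, hK, N, hN⟩ := hAC' 1 one_pos
    obtain ⟨sh, hsh⟩ : ∃ sh : Site 3 → BondConfig (Site 3) → BondConfig (Site 3),
        ∀ (x : Site 3) (ω : BondConfig (Site 3)),
          sh x ω = BondConfig.relabel (sym2Equiv (Site.shift (-x))) ω := ⟨_, fun _ _ => rfl⟩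
    have hflux := fun θ hθm hθi hweak => hZF sh hsh θ hθm hθi (hKW sh hsh θ hθm hθi hweak)
    have hK1 : (1 : ℝ) ≤ K := by exact_mod_cast hK
    obtain ⟨ψ, B, hψm, hψB, hF⟩ := hCA sh hsh hflux (1 / (4 * (K : ℝ) ^ 2)) (by positivity)
    simp only [hsh] at hF
    obtain ⟨Pop, hPop⟩ := exists_pop
    set P := bondPercolation (zdGraph 3) (criticalProbI 3) with hPdef
    -- a large `n ≥ N`
    set n : ℕ := max N (⌈96 * B ^ 2 / c⌉₊ + 1) with hndef
    have hnN : N ≤ n := le_max_left _ _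
    have hn1 : 1 ≤ n := le_trans (Nat.succ_le_succ (Nat.zero_le _)) (le_max_right _ _)
    have hn1' : (1 : ℝ) ≤ n := by exact_mod_cast hn1
    have hnpos : (0 : ℝ) < n := by linarith
    have hnc : 96 * B ^ 2 / c < n := by
      have h1 : ⌈96 * B ^ 2 / c⌉₊ < n := lt_of_lt_of_le (Nat.lt_succ_self _) (le_max_right _ _)
      exact Nat.lt_of_ceil_lt h1
    have hnc' : 96 * B ^ 2 < c * (n : ℝ) ^ 2 := by
      rw [div_lt_iff₀ hc] at hnc
      nlinarith
    obtain ⟨T, hT1, hT2⟩ := hN n hnN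
    have hJ := hT2 Pop hPop
    have hA := secondMoment_le (varianceIdentity_of hDG hCR) hTP hψm hψB T hPop
    -- Chebyshev: `∫_C (𝒫^T 1_{n ≤ x₀})(0) ≤ Λ_T(h²) / n²`
    set deg : BondConfig (Site 3) → ℝ := fun ω =>
      ((((zdGraph 3).neighborFinset (0 : Site 3)).filter (fun y => s((0 : Site 3), y) ∈ ω)).card : ℝ)
      with hdegdef
    have hdeg0 : ∀ ω, 0 ≤ deg ω := fun ω => Nat.cast_nonneg _
    have hdeg6 : ∀ ω, deg ω ≤ 6 := fun ω => DeterministicTime.deg_le_six ω 0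
    have hdeg_meas : Measurable deg := StubStationarity.measurable_card_filter_zero
    set Y2 : Site 3 → ℝ := fun x => ((x 0 : ℤ) : ℝ) ^ 2 with hY2
    set Iup : Site 3 → ℝ := fun x => if (n : ℤ) ≤ x 0 then (1 : ℝ) else 0 with hIup
    have hIup01 : ∀ y, 0 ≤ Iup y ∧ Iup y ≤ 1 := fun y => by
      rw [hIup]; simp only; split_ifs <;> norm_num
    have hY20 : ∀ y, 0 ≤ Y2 y := fun y => by rw [hY2]; positivity
    have hball2 : ∀ y : Site 3, |y 0 - (0 : Site 3) 0| ≤ (T : ℤ) → Y2 y ≤ (T : ℝ) ^ 2 := by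
      intro y hy
      simp only [Pi.zero_apply, sub_zero] at hy
      have h : |((y 0 : ℤ) : ℝ)| ≤ T := by exact_mod_cast hy
      rw [hY2]; simp only
      rw [← sq_abs]
      exact pow_le_pow_left₀ (abs_nonneg _) h 2
    have bY2 : ∀ ω, 0 ≤ ((Pop ω)^[T] Y2) 0 ∧ ((Pop ω)^[T] Y2) 0 ≤ (T : ℝ) ^ 2 := fun ω =>
      Diffusivity.full_iterate_mem_Icc_of_ball hPop ω T 0 (by positivity) hY20 hball2
    have bI : ∀ ω, 0 ≤ ((Pop ω)^[T] Iup) 0 ∧ ((Pop ω)^[T] Iup) 0 ≤ 1 := fun ω =>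
      DeterministicTime.full_iterate_mem_Icc (hPop ω) T hIup01 0
    have hmeas : ∀ F : Site 3 → ℝ, Measurable fun ω => ((Pop ω)^[T] F) 0 := fun F =>
      DeterministicTime.measurable_full_iterate (F := fun _ => F) (fun _ => measurable_const) hPop T 0
    have iY2 : Integrable (fun ω => deg ω * ((Pop ω)^[T] Y2) 0) P := by
      refine Integrable.of_bound (hdeg_meas.mul (hmeas Y2)).aestronglyMeasurable (6 * (T : ℝ) ^ 2)
        (Eventually.of_forall fun ω => ?_)
      rw [Real.norm_eq_abs, abs_of_nonneg (mul_nonneg (hdeg0 ω) (bY2 ω).1)]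
      exact mul_le_mul (hdeg6 ω) (bY2 ω).2 (bY2 ω).1 (by norm_num)
    have iI : Integrable (fun ω => ((Pop ω)^[T] Iup) 0) P :=
      StubStationarity.integrable_of_bounds (hmeas Iup) bI P
    -- pointwise on `{0 ↔ ∞}` a.s.: `(𝒫^T 1_{n≤x₀})(0) ≤ deg·(𝒫^T h²)(0) / n²`
    have hpt : ∀ᵐ ω ∂P, ω ∈ percolatesAt (0 : Site 3) →
        ((Pop ω)^[T] Iup) 0 ≤ (1 / (n : ℝ) ^ 2) * (deg ω * ((Pop ω)^[T] Y2) 0) := by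
      filter_upwards [DeterministicTime.one_le_deg_ae] with ω hω hmem
      have hdeg1 := hω hmem
      have h1 : ((Pop ω)^[T] Iup) 0 ≤ ((Pop ω)^[T] (fun y => (1 / (n : ℝ) ^ 2) * Y2 y)) 0 := by
        refine Diffusivity.full_iterate_mono (hPop ω) T (fun y => ?_) 0
        rw [hIup, hY2]; simp only
        split_ifs with hy
        · have hy' : (n : ℝ) ≤ ((y 0 : ℤ) : ℝ) := by exact_mod_cast hy
          rw [one_div, inv_mul_eq_div, le_div_iff₀ (by positivity), one_mul]
          nlinarith
        · positivity
      rw [Diffusivity.full_iterate_smul (hPop ω) T] at h1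
      simp only at h1
      refine h1.trans ?_
      have h2 : ((Pop ω)^[T] Y2) 0 ≤ deg ω * ((Pop ω)^[T] Y2) 0 :=
        le_mul_of_one_le_left (bY2 ω).1 hdeg1
      exact mul_le_mul_of_nonneg_left h2 (by positivity)
    have hcheb : ∫ ω in percolatesAt (0 : Site 3), ((Pop ω)^[T] Iup) 0 ∂P ≤
        (1 / (n : ℝ) ^ 2) * ∫ ω in percolatesAt (0 : Site 3), deg ω * ((Pop ω)^[T] Y2) 0 ∂P := by
      rw [← integral_const_mul]
      refine setIntegral_mono_on_ae iI.integrableOn (iY2.const_mul _).integrableOn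
        (measurableSet_percolatesAt_holds (0 : Site 3)) ?_
      filter_upwards [hpt] with ω hω hmem using hω hmem
    -- assemble: `2c ≤ J ≤ Λ/n² ≤ (2 T F + 48 B²)/n² ≤ 2 c K² F + 48 B²/n² < c`
    have hT1' : (T : ℝ) ≤ c * ((K : ℝ) * n) ^ 2 := by
      have := hT1; push_cast at this; linarith
    have hFnn : 0 ≤ ∫ ω in percolatesAt (0 : Site 3),
        ∑ y ∈ ((zdGraph 3).neighborFinset (0 : Site 3)).filter (fun y => s((0 : Site 3), y) ∈ ω),
          (((y 0 : ℤ) : ℝ) + ψ (BondConfig.relabel (sym2Equiv (Site.shift (-y))) ω) - ψ ω) ^ 2 ∂P :=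
      setIntegral_nonneg (measurableSet_percolatesAt_holds (0 : Site 3)) fun ω _ =>
        Finset.sum_nonneg fun y _ => sq_nonneg _
    set F := ∫ ω in percolatesAt (0 : Site 3),
        ∑ y ∈ ((zdGraph 3).neighborFinset (0 : Site 3)).filter (fun y => s((0 : Site 3), y) ∈ ω),
          (((y 0 : ℤ) : ℝ) + ψ (BondConfig.relabel (sym2Equiv (Site.shift (-y))) ω) - ψ ω) ^ 2 ∂P
      with hFdef
    set Λ := ∫ ω in percolatesAt (0 : Site 3), deg ω * ((Pop ω)^[T] Y2) 0 ∂P with hΛdef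
    set J := ∫ ω in percolatesAt (0 : Site 3), ((Pop ω)^[T] Iup) 0 ∂P with hJdef
    have hΛnn : 0 ≤ Λ := setIntegral_nonneg (measurableSet_percolatesAt_holds (0 : Site 3))
      fun ω _ => mul_nonneg (hdeg0 ω) (bY2 ω).1
    have hn2 : (0 : ℝ) < (n : ℝ) ^ 2 := by positivity
    -- `Λ ≤ 2 T F + 48 B²` and `T F ≤ c K² n² F`, `F < 1/(4K²)`
    have e1 : J * (n : ℝ) ^ 2 ≤ Λ := by
      have h := mul_le_mul_of_nonneg_right hcheb hn2.le
      have e : 1 / (n : ℝ) ^ 2 * Λ * (n : ℝ) ^ 2 = Λ := by field_simp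
      linarith
    have e2 : Λ ≤ 2 * (T : ℝ) * F + 48 * B ^ 2 := hA
    have e3 : (T : ℝ) * F ≤ c * ((K : ℝ) * n) ^ 2 * F := mul_le_mul_of_nonneg_right hT1' hFnn
    have e4 : c * ((K : ℝ) * n) ^ 2 * F ≤ c * ((K : ℝ) * n) ^ 2 * (1 / (4 * (K : ℝ) ^ 2)) :=
      mul_le_mul_of_nonneg_left hF.le (by positivity)
    have e5 : c * ((K : ℝ) * n) ^ 2 * (1 / (4 * (K : ℝ) ^ 2)) = c * (n : ℝ) ^ 2 / 4 := by
      field_simp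
    have e6 : 2 * c ≤ J := hJ
    have e7 : 2 * c * (n : ℝ) ^ 2 ≤ J * (n : ℝ) ^ 2 := mul_le_mul_of_nonneg_right e6 hn2.le
    nlinarith [e1, e2, e3, e4, e5, e7, hnc', hc, hn2]
  · intro h0 hθ
    rw [h0] at hθ
    exact absurd hθ (lt_irrefl 0)

end Glue

end Summit.CriticalPhenomena.PercolationContinuityZ3.Cruxes.VerticalGamblersRuin.Birth

end
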